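import Summits.ValiantsHypothesis.ValiantsHypothesis.Theses.RealTau
import Literature.Computability.AlgebraicComplexity.RealTauKnownCases
import Literature.Computability.AlgebraicComplexity.TauConjecture

/-!
# Disproof of `RealTauRefined` — findings

Crux `RealTau.RealTauRefined` (stmt-ValiantsHypothesis-18101) = Tavenas 2014, Conj. 3.23 (refined real
τ-conjecture, "au plus p(k t 2^m)" in the normal form `2^(a(m+1)) (k+t+2)^a`).  NO KILL: the statement
is the printed open conjecture, not finitely falsifiable (`∃ a` over unbounded `k, m, t`).  Everything in
this file is sorry-free (standard axioms).

## Part I — birth attack (refuter-rattack-…-18101, 2026-08-17; LANDED as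
`Theorems/RealTauRefined/Negative/LoadBearing.lean`, p143063)

* (e) `realTauRefined_iff_without_ne_zero` — the hypothesis `F ≠ 0` is decoration (`roots 0 = 0`).
* (b) `realTauRefined_bound_fails_at_zero` — the conclusion is not trivial: `a = 0` dies on `X(X-1)`.
* (a) LOAD-BEARING ANALYSIS — each ingredient of the bound is necessary:
  - `realTauRefined_false_without_sparsity` : drop `#supp f_ij ≤ t`      → false (`∏_{i<N}(X-i)`);
  - `realTauRefined_false_without_pow_m`    : drop the factor `2^(a(m+1))` (bound `(k+t+2)^a`)
                                              → false (`k = 1`, `t = 2`, `∏_{j<m}(X-j)`);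
  - `realTauRefined_false_without_k`        : drop `k` from the base (bound `2^(a(m+1)) (t+2)^a`)
                                              → false (`m = t = 1`, monomials `C(coeff_i P) X^i`).
* (c) WEAKENINGS THAT ARE ALREADY THEOREMS (so the `∃ a`-first quantifier order is essential):
  - `realTauRefined_forall_m_exists_a`, `realTauRefined_forall_t_exists_a` — with `a` depending on
    `m` or on `t`, Descartes' `2kt^m - 1` (tree `card_roots_toFinset_sumProd_sparse_le`) suffices;
    the conjecture's content is uniformity as `m → ∞` AND `t → ∞` jointly, with `k ≥ 2`
    (`k ≤ 1`: tree `koiranRealTauConjecture_of_k_le_one`);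
  - `realTauRefined_case_t_le_two` — binomial inputs hold with `a = 1`.
* (d) `realTauRefined_of_tauReal` — `TauReal → RealTauRefined` (support item OfKoiran; `TauReal` is the
      tree's `KoiranRealTauConjecture` by `Iff.rfl`), so the crux is the WEAKER printed form.

## Part II — cdisprove cycle 1 (refuter-cdisprove-…-18101-0, 2026-08-17; sections (f)–(j) below)

* (f) TIGHTNESS ONE STEP UP: `realTauRefined_bound_fails_at_one` — the body at `a = 1` is false too
      (`m = 1`, `k = t = 12`, `∏_{i<121}(X - i)` cut into 12 blocks of 12 monomials: 121 > 104 zeros;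
      helper `sum_blocks_eq` = block decomposition of any polynomial).  So a witness exponent is `≥ 2`;
      `a = 2` is NOT known to fail — every ΣΠ-sparse family in print or found by search has `O(kmt)` zeros.
* (g) NATURAL STRENGTHENINGS THAT ARE FALSE (cheap, but they fence the statement):
  - `not_realTauRefined_withMultiplicity` — counting zeros with multiplicity (`roots.card`) dies on `X^N`
    (Hrubeš 2013 Conj. 2.1 counts NONZERO zeros with multiplicity and is equivalent to the crux);
  - `not_realTauRefined_complex` — the same statement over `ℂ` dies on `X^N - 1` (all `N` roots of unity):
    the ORDER of `ℝ` is the entire content, as the route's rationale says.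
* (h) POSITIVE HALF-LINE NORMAL FORM: `realTauRefined_iff_pos` — the crux is equivalent (`a ↦ a + 1`) to
      bounding only the zeros in `(0, ∞)` (`F(-X)` is again `(k,m,t)`-sparse; `0` counts once).  Provers may
      therefore work with exponential sums `u ↦ F(e^u)` on `ℝ`; disprovers need positive zeros only.
* (i) LINE `fischer-powers` (lead's pick, `Lines/fischer_powers.lean`): `equalPowerSigned_of_realTauRefined`,
      `waringOnCurve_of_realTauRefined`, `stub_waringOnCurve_of_realTauRefined` (r1) and
      `stub_waringLargeK_of_realTauRefined` (lead's reshape r2, open core `K ≥ 3`) — the crux implies the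
      antecedent of `stub_fischer` and the open stub `stub_waringOnCurve` with the SAME exponent (a signed sum
      of `K` `m`-th powers of `T`-sparse polynomials is a `(K, m, T)` expression: sign on the first factor).
      With the line's two TRUE stubs this makes stub 1 ⟺ crux (kernel-checked in one direction here, the
      other is the line itself): the line is a normal-form redirect, and `StrictMono e` in stub 1 is cosmetic
      (the crux gives the bound without it).  Consequence for disprovers: a kill of stub 1 IS a kill of the
      crux — search in Waring form is legitimate and loses nothing.
* (j) CALIBRATION SEARCHES (kit jobs j023898 / j023899 / j023901, deep re-runs j024061 / j024072, odd-m and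
      wide-range probes j024175; one batched script `job1/main.py`,
      numerical hill-climbing on the number of sign changes of `F(e^u)` on a grid, every record re-counted
      in 60-digit arithmetic; table in the comment block of section (j) below and in the jobs' `table.txt`):
      maximal numbers of POSITIVE zeros found for `(k,m,t)`-expressions, `f g + 1`, and the Waring form,
      against Descartes' cap `k t^m - 1` and the linear count `k m (t-1) + k - 1`.
* (k) THE ADDITIVE COUNT: `AdditiveCount` (`Z₊ ≤ k m (t-1) + k - 1`, the linear guess made sharp),
      `realTauRefined_of_additiveCount` (PROVED: it implies the crux with `a = 2`, via the positive-half-line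
      splitting `card_roots_le_of_pos_bound`), and `AdditiveCountAttained` (paper proposition, scale
      separation: the additive count is attained for all `k, m ≥ 1`, `t ≥ 2`, so any valid bound is
      `Ω(kmt)`; the instance `(2,2,2)` — 5 positive zeros from two products of two binomials, more than the
      2 + 2 of the products separately — is KERNEL-CHECKED: `additiveCount_attained_2_2_2`; so is the Waring base case
      `waringCount_attained_3_2_2` — three signed squares of binomials, 8 positive zeros — both through the
      reusable sign-alternation certificate `le_card_pos_roots_of_alternating`).  Waring calibration (even m:
      `2KT - K - 1` m-uniformly, explicit family; odd m: more — 9 at (3,2,5) — so only `poly(K,T)` m-free is a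
      safe guess) in the block before the certificate.  All numerical maxima of (j) are `≤` the additive count, with equality where the search is
      strong.  For provers: `a = 2` is the natural target exponent; for disprovers: the first thing to break
      is additivity at `(2,2,2)` (5 vs Descartes 7) or `fg+1`, `t = 3` (5 vs 9) — harmless to the crux, but
      the only place where "interaction beyond additivity" could first be observed.

## Why it resists (for the provers; heuristics, not theorems)

1. FEATURE ADDITIVITY.  On `(0,∞)` write `x = e^u`.  For one product, `log |∏_j f_j(e^u)| = Σ_j log|f_j(e^u)|`
   is a sum of `m` curves each with `≤ t - 1` bends (positive coefficients: convex log-sum-exp) or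
   `≤ t - 1` spikes to `-∞` (sign changes); zeros of `P ± Q` sit where two such sums cross with the right
   signs.  In the tropical limit (bends → corners) a difference of two convex PL functions with `B₁, B₂`
   corners has `≤ B₁ + B₂ + 1` zeros, i.e. `O(mt)`; smoothing a corner of steepness `γ` into a logistic
   step of height `γ` and width `1/γ` (height and width are COUPLED for a binomial bend) adds `O(1)` per
   pair.  Every construction tried (nested scales `f_j(x^{b^j})`, translates `f(θ_j x)`, telescoping
   `∏ f_j - ∏ g_j` with `g_j ≈ f_j`, Hermite–Biehler real parts `Re ∏ f_j` with upper-half-plane-rooted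
   complex sparse `f_j` — which gives EXACTLY `Σ deg f_j ≤ m(2t-1)` real zeros, all simple) lands at
   `O(kmt)`.  A counterexample must make features INTERACT non-additively: massive structured cancellation
   between products leaving an oscillating residual.
2. SIGN CHANGES ARE NOT ZEROS.  `(1 - x) ∏_{j<m} (1 + β_j x^{2^j}) - (1 - w x^{2^m})` (a `(2, m+1, 2)`
   expression) equals `Σ_{0<n<2^m} (w(n) - w(n-1)) x^n` with `w` digit-multiplicative, whose coefficient
   signs follow the ruler sequence: `≈ 2^{m-1}` Descartes sign changes — but its positive zeros are those
   of `∏ f_j(x^{2^j}) = 1 - w x^{2^m}`, `O(m)` many.  Any search must count zeros (or isolated alternating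
   edges of the archimedean Newton polygon), never sign changes of coefficients.
3. WHERE A COUNTEREXAMPLE CAN LIVE (all three typed elsewhere in this crux directory): (i) cancellation
   designs exposing a `t^{Ω(m)}`-vertex sign-alternating pocket of the Newton polygon of
   `∏ f_j(x,y) - ∏ g_j(x,y)` (card `viro-pocket-carving`; needs exact arithmetic — invisible to floating
   point, and the dissociated sub-case is provably shallow); (ii) succinct ΣΠ-sparse representations of
   `(x+1)^n` over `ℂ` (card `negation-hrubes-binomial`); (iii) a VP upper bound for the multilinear lift of
   Tavenas' `V_n` (route kill criterion (ii)).  None is approachable by unstructured search: the number of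
   free parameters is `2kmt` against `t^{Ω(m)}` cancellation conditions, so only an IDENTITY can do it.
4. REGIME.  By Part I (c) and (f): a refuting family needs `k ≥ 2`, `t ≥ 3` with `t → ∞`, `m → ∞`,
   `m log t ≫ a (m + log(k+t))`, and more than `2^{2(m+1)} (k+t+2)^2` zeros already to beat `a = 2` — e.g.
   at `m = 2` that is `> 64 (k+t+2)^2` zeros from `≤ 2 k t^2` monomials, so `k, t ≳ 130`, degree in the
   millions: no finite experiment bears on the crux directly; experiments can only measure the growth RATE
   in `m` at fixed small `t` (which bears on Koiran's `TauReal`, not on the refined form: `t ≤ 2` is a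
   theorem with `a = 1`, and fixed `t` always has its own `a`).

## Part III — cdisprove gen 2, cycle 1 (refuter-cdisprove-…-18101-g2-0, 2026-08-17; sections (l)–(q) below)

* (l) LOAD-BEARING SQUARE COMPLETED: `realTauRefined_false_without_t` — drop `t` from the base (bound
      `2^(a(m+1)) (k+2)^a`) → false (`k = m = 1`, one `(N+1)`-sparse `∏_{i<N}(X-i)`).  With Part I (a):
      each of sparsity, `2^m`, `k`, `t` is necessary in the bound.
* (m) THE ADDITIVE COUNT IS ATTAINED ON BOTH DESCARTES FACES, ALL PARAMETERS (kernel-checked families, not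
      instances): `additiveCount_attained_m_one` (`k t - 1` positive zeros from `k` blocks of `t` monomials of
      `∏_{i<kt-1}(X-(i+1))`, every `k, t ≥ 1`) and `additiveCount_attained_k_one` (`m (t-1)` positive zeros
      from one product of `m` shifted `∏_{l<t-1}(X - (j(t-1)+l+1))`, every `m`, `t ≥ 1`).  So any valid bound
      is `≥ max (k t - 1, m (t-1))`; the interaction term is certified only at `(2,2,2)` (Part II (k)).
* (n) THE LEAD'S SUB-TARGET Q1 CONTAINS THE `fg + 1` PROBLEM: `card_roots_fg_sub_one_le_of_quadraticStratum`
      (+ `roots_fg_add_one`) — a zero bound `B T` for `p q - b²` with `p, q, b` co-supported `T`-nomials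
      (= rank-3 quadratic forms on one support, the lead's "first count" Q1, crux NOTES cycle 2) gives
      `Z(fg ∓ 1) ≤ B(2t+1)` for `t`-sparse `f, g` by support padding.  So "is Q1 `Θ(T)`?" is, in the
      upper-bound direction, AT LEAST Koiran's 2011 `fg + 1` question (KPT15 §1, Dutta21 §1.1; open); only its
      lower-bound direction is a calibration experiment (section (q)).
* (o) CO-SUPPORTED FORMS CANNOT BE SCALE-SEPARATED: `coSupported_dominance_propagates` — with common slopes
      `e_l`, a form whose `T` lines all tie at `u₀` and which dominates a co-supported form there dominates it
      at every `u ≥ u₀` (top slope; symmetrically `u ≤ u₀`, bottom slope).  Hence in the Waring normal form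
      `Σ_{i<K} ε_i h_i^m` (co-supported `h_i`, `stub_waringCore`) at most ONE `h_i` is fully Descartes-active
      where it dominates: the disjoint-window mechanism of Part II (k) (`2K(T-1)+K-1` zeros; it needs the
      monomial prefactors `x^{A i}`, i.e. DIFFERENT supports) is unavailable, the lines of the `K` forms must
      SHARE the `T` slopes (form `i` active on a slope interval `L_i`, `Σ|L_i| ≲ T + K`), and scale separation
      yields only `≈ 2T + O(K)` zeros, essentially `K`-free.  Reading for the lead: in co-supported Waring form
      every zero beyond `O(T + K)` is a TIE zero (cancellation between forms of comparable magnitude), never a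
      Descartes zero of one form; the natural calibration guess there is `poly(T) + O(K)`, m-free — consistent
      with FixedK/Pencil and with Fischer (`K = k 2^m`, `T = m t`: `O(T + K) = O(mt + k 2^m)`).
* (p) WHY KILL ROUTE (ii) CANNOT USE READ-ONCE PRODUCTS (paper analysis, this seat; no Lean): the cheapest
      "VP-lift" designs are Kronecker products `p_n(x) = e₁ᵀ ∏_{i<n} (A_i + x^{2^i} B_i) e₁` (width-`w` ROABPs;
      block multiplication gives `(k,m,t) = (w^{√n}, √n, 2^{√n})` expressions, so `2^{n^{1/2+δ}}` real zeros
      would refute the crux for every `a`).  Their coefficients are `c_s = e₁ᵀ ∏_i (B_i if bit_i(s) else A_i) e₁`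
      and a TROPICALLY CERTIFIED real zero (one monomial dominating all others on an annulus — the mechanism
      behind ALL `2^n - 1` zeros of Tavenas' `V_n`, Hutchinson's constant 4) is a breakpoint of
      `ρ ↦ max_s (log|c_s| + ρ s) ≤ max over state paths = a parametric LONGEST-PATH value in a layered graph
      with `n w` nodes and edge costs affine in `ρ`; by Gusfield's parametric shortest-path bound (1980;
      Carstensen 1983 for the matching `n^{Ω(log n)}` lower bound) it has at most `(nw)^{O(log(nw))}` linear
      pieces.  So read-once designs certify at most quasi-polynomially many zeros — far below `2^{√n}` — and
      `V_n`'s multilinear lift itself has ROABP width `≥ 2^{⌊n/2⌋}` in the natural order (Nisan rank of the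
      coefficient matrix `[16^{-ab}]_{a,b}`, a nonsingular Vandermonde).  A kill via (ii) needs genuinely
      non-read-once circuits (or non-certified, cancellation zeros), i.e. the open question "is the theta /
      rank-one-Ising lift in VP" in full.
* (q) LP-CERTIFIED ALTERNATION SEARCH (lead's `disprover-wanted`; kit j025721, smoke j025675; script
      `job/main.py` in the seat folder, method and table in the comment block of section (q) at the end of this
      file): problems A = Q1 (`p q - b²` co-supported, `T = 4…24`), B = TwoSparseMaps (`P(δ,η)`, `m = 2,3`,
      `T = 8…16`), C = `(2,2,t)` (`f₁f₂ + g₁g₂`, `t = 3…12`); every record re-verified in exact rational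
      arithmetic (certificates in the job's `outputs/results.json`).

## Why it resists (addendum, gen 2)

5. NORMAL FORMS DO NOT LOCALISE.  Fischer's image is co-supported, and (o) shows co-support forbids the only
   constructive lower-bound mechanism we have (window separation); conversely every upper-bound tool that IS
   uniform in `K` (Pencil: rank ≤ 2) uses that the forms are proportional on rays.  Rank 3 at `m = 2` is
   already `fg + 1`-hard (n).  So the first honest open case of the line is literally the 2011 calibration
   rung, and the first honest kill design must be a tie/cancellation design (Why-it-resists §3 (i)) or a
   non-read-once VP lift (p).
-/

open Polynomial Finset
open Literature.Computability.AlgebraicComplexity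

set_option linter.dupNamespace false

namespace Summit.ValiantsHypothesis.ValiantsHypothesis.Cruxes.RealTauRefined.Disproof

open Summit.ValiantsHypothesis.ValiantsHypothesis.Theses.RealTau

/-! ### (e) the `≠ 0` hypothesis is decoration -/

/-- `RealTauRefined` with the hypothesis `F ≠ 0` removed. -/
def RealTauRefinedWithoutNeZero : Prop :=
  ∃ a : ℕ, ∀ (k m t : ℕ) (f : Fin k → Fin m → Polynomial ℝ),
    (∀ i j, (f i j).support.card ≤ t) →
      (∑ i, ∏ j, f i j).roots.toFinset.card ≤ 2 ^ (a * (m + 1)) * (k + t + 2) ^ a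

/-- `F ≠ 0` is decoration: `Polynomial.roots 0 = 0`. [folklore] -/
theorem realTauRefined_iff_without_ne_zero : RealTauRefined ↔ RealTauRefinedWithoutNeZero := by
  constructor
  · rintro ⟨a, ha⟩
    refine ⟨a, fun k m t f hf => ?_⟩
    by_cases hF : (∑ i, ∏ j, f i j) = 0
    · simp [hF]
    · exact ha k m t f hf hF
  · rintro ⟨a, ha⟩
    exact ⟨a, fun k m t f hf _ => ha k m t f hf⟩

/-! ### (b) the exponent `a = 0` fails -/

/-- The witness `X (X - 1)` as a product of linear factors over `{0, 1}`. -/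
noncomputable def p2 : Polynomial ℝ :=
  (((Multiset.range 2).map ((↑) : ℕ → ℝ)).map fun r => X - C r).prod

theorem card_roots_p2 : p2.roots.toFinset.card = 2 := by
  have hnd : ((Multiset.range 2).map ((↑) : ℕ → ℝ)).Nodup :=
    (Multiset.nodup_range 2).map Nat.cast_injective
  rw [p2, roots_multiset_prod_X_sub_C, Multiset.toFinset_card_of_nodup hnd, Multiset.card_map,
    Multiset.card_range]

theorem p2_ne_zero : p2 ≠ 0 :=
  (monic_multiset_prod_of_monic _ _ fun r _ => monic_X_sub_C r).ne_zero

theorem card_support_p2 : p2.support.card ≤ 3 := by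
  have hdeg : p2.natDegree = 2 := by
    rw [p2, natDegree_multiset_prod_X_sub_C_eq_card, Multiset.card_map, Multiset.card_range]
  exact (card_supp_le_succ_natDegree p2).trans (by rw [hdeg])

/-- Non-vacuity: the hypotheses of the crux are met by a non-degenerate instance with real zeros. -/
theorem realTauRefined_hyps_satisfiable :
    ∃ (k m t : ℕ) (f : Fin k → Fin m → Polynomial ℝ),
      (∀ i j, (f i j).support.card ≤ t) ∧ (∑ i, ∏ j, f i j) ≠ 0 ∧
        0 < (∑ i, ∏ j, f i j).roots.toFinset.card := by
  refine ⟨1, 1, 3, fun _ _ => p2, fun _ _ => card_support_p2, ?_, ?_⟩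
  · simpa using p2_ne_zero
  · have key : (∑ _i : Fin 1, ∏ _j : Fin 1, p2) = p2 := by simp
    rw [key, card_roots_p2]; norm_num

/-- Tightness at the bottom: the body of `RealTauRefined` at `a = 0` (bound `≡ 1`) is false,
witness `X(X-1)` (`k = m = 1`, `t = 3`). [folklore] -/
theorem realTauRefined_bound_fails_at_zero :
    ¬ ∀ (k m t : ℕ) (f : Fin k → Fin m → Polynomial ℝ),
      (∀ i j, (f i j).support.card ≤ t) → (∑ i, ∏ j, f i j) ≠ 0 →
        (∑ i, ∏ j, f i j).roots.toFinset.card ≤ 2 ^ (0 * (m + 1)) * (k + t + 2) ^ 0 := by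
  intro ha
  have h := ha 1 1 3 (fun _ _ => p2) (fun _ _ => card_support_p2) (by simpa using p2_ne_zero)
  have key : (∑ _i : Fin 1, ∏ _j : Fin 1, p2) = p2 := by simp
  rw [key, card_roots_p2] at h
  norm_num at h

/-! ### (a) load-bearing analysis -/

/-- `RealTauRefined` with the sparsity hypothesis dropped. -/
def RealTauRefinedWithoutSparsity : Prop :=
  ∃ a : ℕ, ∀ (k m t : ℕ) (f : Fin k → Fin m → Polynomial ℝ), (∑ i, ∏ j, f i j) ≠ 0 →
    (∑ i, ∏ j, f i j).roots.toFinset.card ≤ 2 ^ (a * (m + 1)) * (k + t + 2) ^ a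

/-- Any proof must use sparsity: without it, `∏_{i<N} (X - i)` (`k = m = 1`, `t = 0`,
`N = 4^a 3^a + 1`) breaks every exponent `a`. [folklore] -/
theorem realTauRefined_false_without_sparsity : ¬ RealTauRefinedWithoutSparsity := by
  rintro ⟨a, ha⟩
  set N : ℕ := 2 ^ (a * (1 + 1)) * (1 + 0 + 2) ^ a + 1 with hN
  set s : Multiset ℝ := (Multiset.range N).map ((↑) : ℕ → ℝ) with hs
  set P : Polynomial ℝ := (s.map fun r => X - C r).prod with hP
  have hnd : s.Nodup := (Multiset.nodup_range N).map Nat.cast_injective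
  have hcard : P.roots.toFinset.card = N := by
    rw [hP, roots_multiset_prod_X_sub_C, Multiset.toFinset_card_of_nodup hnd, hs,
      Multiset.card_map, Multiset.card_range]
  have hP0 : P ≠ 0 := by
    rw [hP]; exact (monic_multiset_prod_of_monic _ _ fun r _ => monic_X_sub_C r).ne_zero
  have h := ha 1 1 0 (fun _ _ => P) (by simpa using hP0)
  have key : (∑ _i : Fin 1, ∏ _j : Fin 1, P) = P := by simp
  rw [key, hcard] at h
  omega

/-- `RealTauRefined` with the factor `2^(a(m+1))` dropped: a bound polynomial in `k, t` alone. -/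
def RealTauRefinedWithoutPowM : Prop :=
  ∃ a : ℕ, ∀ (k m t : ℕ) (f : Fin k → Fin m → Polynomial ℝ), (∀ i j, (f i j).support.card ≤ t) →
    (∑ i, ∏ j, f i j) ≠ 0 → (∑ i, ∏ j, f i j).roots.toFinset.card ≤ (k + t + 2) ^ a

/-- Any proof must let the bound grow with `m`: one product of `m` binomials `∏_{j<m} (X - j)`
(`k = 1`, `t = 2`, `m = 5^a + 1`) has `m` distinct real zeros. [folklore] -/
theorem realTauRefined_false_without_pow_m : ¬ RealTauRefinedWithoutPowM := by
  rintro ⟨a, ha⟩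
  set N : ℕ := (1 + 2 + 2) ^ a + 1 with hN
  have hprod : (∏ j : Fin N, (X - C ((j : ℕ) : ℝ))) =
      (((Multiset.range N).map ((↑) : ℕ → ℝ)).map fun r => X - C r).prod := by
    rw [Fin.prod_univ_eq_prod_range (fun i : ℕ => X - C (i : ℝ)) N, Finset.prod_eq_multiset_prod,
      Finset.range_val, Multiset.map_map]
    rfl
  have hnd : ((Multiset.range N).map ((↑) : ℕ → ℝ)).Nodup :=
    (Multiset.nodup_range N).map Nat.cast_injective
  have hcard : (∏ j : Fin N, (X - C ((j : ℕ) : ℝ))).roots.toFinset.card = N := by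
    rw [hprod, roots_multiset_prod_X_sub_C, Multiset.toFinset_card_of_nodup hnd, Multiset.card_map,
      Multiset.card_range]
  have hne : (∏ j : Fin N, (X - C ((j : ℕ) : ℝ))) ≠ 0 := by
    rw [hprod]; exact (monic_multiset_prod_of_monic _ _ fun r _ => monic_X_sub_C r).ne_zero
  have hsupp : ∀ j : Fin N, (X - C ((j : ℕ) : ℝ)).support.card ≤ 2 := fun j =>
    (card_supp_le_succ_natDegree _).trans (by rw [natDegree_X_sub_C])
  have key : (∑ _i : Fin 1, ∏ j : Fin N, (X - C ((j : ℕ) : ℝ))) =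
      ∏ j : Fin N, (X - C ((j : ℕ) : ℝ)) := by simp
  have h := ha 1 N 2 (fun _ j => X - C ((j : ℕ) : ℝ)) (fun _ j => hsupp j) (by rw [key]; exact hne)
  rw [key, hcard] at h
  omega

/-- `RealTauRefined` with `k` dropped from the base: a bound in `m, t` alone. -/
def RealTauRefinedWithoutK : Prop :=
  ∃ a : ℕ, ∀ (k m t : ℕ) (f : Fin k → Fin m → Polynomial ℝ), (∀ i j, (f i j).support.card ≤ t) →
    (∑ i, ∏ j, f i j) ≠ 0 → (∑ i, ∏ j, f i j).roots.toFinset.card ≤ 2 ^ (a * (m + 1)) * (t + 2) ^ a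

/-- Any proof must let the bound grow with `k`: `∏_{i<N} (X - i)` written monomial by monomial is a
sum of `k = N + 1` products of `m = 1` polynomial with `t = 1` monomial (`N = 12^a + 1`). [folklore] -/
theorem realTauRefined_false_without_k : ¬ RealTauRefinedWithoutK := by
  rintro ⟨a, ha⟩
  set N : ℕ := 2 ^ (a * (1 + 1)) * (1 + 2) ^ a + 1 with hN
  set s : Multiset ℝ := (Multiset.range N).map ((↑) : ℕ → ℝ) with hs
  set P : Polynomial ℝ := (s.map fun r => X - C r).prod with hP
  have hnd : s.Nodup := (Multiset.nodup_range N).map Nat.cast_injective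
  have hsN : Multiset.card s = N := by rw [hs, Multiset.card_map, Multiset.card_range]
  have hcard : P.roots.toFinset.card = N := by
    rw [hP, roots_multiset_prod_X_sub_C, Multiset.toFinset_card_of_nodup hnd, hsN]
  have hP0 : P ≠ 0 := by
    rw [hP]; exact (monic_multiset_prod_of_monic _ _ fun r _ => monic_X_sub_C r).ne_zero
  have hdeg : P.natDegree = N := by
    rw [hP, natDegree_multiset_prod_X_sub_C_eq_card, hsN]
  have key : (∑ i : Fin (N + 1), ∏ _j : Fin 1, C (P.coeff (i : ℕ)) * X ^ (i : ℕ)) = P := by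
    simp only [Finset.prod_const, Finset.card_univ, Fintype.card_fin, pow_one]
    rw [Fin.sum_univ_eq_sum_range (fun i => C (P.coeff i) * X ^ i) (N + 1), ← hdeg]
    exact (as_sum_range_C_mul_X_pow P).symm
  have h := ha (N + 1) 1 1 (fun i _ => C (P.coeff (i : ℕ)) * X ^ (i : ℕ))
    (fun _ _ => card_support_C_mul_X_pow_le_one) (by rw [key]; exact hP0)
  rw [key, hcard] at h
  omega

/-! ### (c) weakenings that are already theorems -/

/-- Quantifier order is essential: with `a` depending on `m`, Descartes' bound suffices.
[cite: Koiran2011, §6 p. 317 (bound 2kt^m - 1)] -/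
theorem realTauRefined_forall_m_exists_a :
    ∀ m : ℕ, ∃ a : ℕ, ∀ (k t : ℕ) (f : Fin k → Fin m → Polynomial ℝ),
      (∀ i j, (f i j).support.card ≤ t) → (∑ i, ∏ j, f i j) ≠ 0 →
        (∑ i, ∏ j, f i j).roots.toFinset.card ≤ 2 ^ (a * (m + 1)) * (k + t + 2) ^ a := by
  intro m
  refine ⟨m + 1, fun k t f hf hF => ?_⟩
  have h := card_roots_toFinset_sumProd_sparse_le f hf hF
  have h1 : k * t ^ m ≤ (k + t + 2) ^ (m + 1) := by
    rw [pow_succ']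
    exact Nat.mul_le_mul (by omega) (Nat.pow_le_pow_left (by omega) m)
  have h2 : 2 ≤ 2 ^ ((m + 1) * (m + 1)) :=
    calc (2 : ℕ) = 2 ^ 1 := by norm_num
      _ ≤ 2 ^ ((m + 1) * (m + 1)) := Nat.pow_le_pow_right (by norm_num) (by nlinarith)
  calc _ ≤ 2 * (k * t ^ m) - 1 := h
    _ ≤ 2 * (k * t ^ m) := Nat.sub_le _ _
    _ ≤ 2 ^ ((m + 1) * (m + 1)) * (k + t + 2) ^ (m + 1) := Nat.mul_le_mul h2 h1

/-- Quantifier order is essential: with `a` depending on `t`, Descartes' bound suffices too.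
[cite: Koiran2011, §6 p. 317 (bound 2kt^m - 1)] -/
theorem realTauRefined_forall_t_exists_a :
    ∀ t : ℕ, ∃ a : ℕ, ∀ (k m : ℕ) (f : Fin k → Fin m → Polynomial ℝ),
      (∀ i j, (f i j).support.card ≤ t) → (∑ i, ∏ j, f i j) ≠ 0 →
        (∑ i, ∏ j, f i j).roots.toFinset.card ≤ 2 ^ (a * (m + 1)) * (k + t + 2) ^ a := by
  intro t
  refine ⟨t + 1, fun k m f hf hF => ?_⟩
  have h := card_roots_toFinset_sumProd_sparse_le f hf hF
  have ht2 : t ^ m ≤ 2 ^ (t * m) := by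
    rw [pow_mul]; exact Nat.pow_le_pow_left (Nat.lt_two_pow_self).le m
  have h2 : 2 * t ^ m ≤ 2 ^ ((t + 1) * (m + 1)) :=
    calc 2 * t ^ m ≤ 2 * 2 ^ (t * m) := Nat.mul_le_mul_left 2 ht2
      _ = 2 ^ (t * m + 1) := (pow_succ' 2 (t * m)).symm
      _ ≤ 2 ^ ((t + 1) * (m + 1)) := Nat.pow_le_pow_right (by norm_num) (by nlinarith)
  have hk : k ≤ (k + t + 2) ^ (t + 1) :=
    calc k ≤ k + t + 2 := by omega
      _ ≤ (k + t + 2) ^ (t + 1) := Nat.le_self_pow (by omega) _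
  calc _ ≤ 2 * (k * t ^ m) - 1 := h
    _ ≤ 2 * (k * t ^ m) := Nat.sub_le _ _
    _ = (2 * t ^ m) * k := by ring
    _ ≤ 2 ^ ((t + 1) * (m + 1)) * (k + t + 2) ^ (t + 1) := Nat.mul_le_mul h2 hk

/-- Cheap special case: binomial inputs (`t ≤ 2`) satisfy the bound with `a = 1`.
[cite: Koiran2011, §6 p. 317 (bound 2kt^m - 1)] -/
theorem realTauRefined_case_t_le_two (k m t : ℕ) (ht : t ≤ 2) (f : Fin k → Fin m → Polynomial ℝ)
    (hf : ∀ i j, (f i j).support.card ≤ t) (hF : (∑ i, ∏ j, f i j) ≠ 0) :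
    (∑ i, ∏ j, f i j).roots.toFinset.card ≤ 2 ^ (1 * (m + 1)) * (k + t + 2) ^ 1 := by
  have h := card_roots_toFinset_sumProd_sparse_le f hf hF
  have htm : t ^ m ≤ 2 ^ m := Nat.pow_le_pow_left ht m
  calc _ ≤ 2 * (k * t ^ m) - 1 := h
    _ ≤ 2 * (k * t ^ m) := Nat.sub_le _ _
    _ ≤ 2 * (k * 2 ^ m) := by gcongr
    _ = 2 ^ (1 * (m + 1)) * k := by ring
    _ ≤ 2 ^ (1 * (m + 1)) * (k + t + 2) ^ 1 := by
        rw [pow_one]; exact Nat.mul_le_mul_left _ (by omega)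

/-! ### (d) relation to Koiran's form -/

/-- Koiran's form implies Tavenas' refined form, via `(k+m+t+2)^c ≤ 2^(c(m+1)) (k+t+2)^c`
(support item `OfKoiran`). [cite: Tavenas2014, Conj. 3.23 after Conj. 3.2] -/
theorem realTauRefined_of_tauReal : TauReal → RealTauRefined := by
  rintro ⟨c, hc⟩
  refine ⟨c, fun k m t f hf hF => (hc k m t f hf hF).trans ?_⟩
  have h1 : k + m + t + 2 ≤ 2 ^ (m + 1) * (k + t + 2) :=
    calc k + m + t + 2 ≤ (m + 1 + 1) * (k + t + 2) := by nlinarith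
      _ ≤ 2 ^ (m + 1) * (k + t + 2) := Nat.mul_le_mul_right _ Nat.lt_two_pow_self
  calc (k + m + t + 2) ^ c ≤ (2 ^ (m + 1) * (k + t + 2)) ^ c := Nat.pow_le_pow_left h1 c
    _ = 2 ^ (c * (m + 1)) * (k + t + 2) ^ c := by rw [mul_pow, ← pow_mul, mul_comm (m + 1) c]

/-- Hence the crux follows from the tree's registered open `KoiranRealTauConjecture`
(`TauReal` is that statement by `Iff.rfl`). -/
theorem realTauRefined_of_koiranRealTauConjecture (h : KoiranRealTauConjecture) : RealTauRefined :=
  realTauRefined_of_tauReal h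

example : TauReal ↔ KoiranRealTauConjecture := Iff.rfl


/-! ## Part II — cdisprove cycle 1 -/

/-! ### (f) tightness one step up: `a = 1` fails -/

/-- A sum of `T` monomials has at most `T` monomials. -/
theorem card_support_sum_CXpow_le (T : ℕ) (a : Fin T → ℝ) (e : Fin T → ℕ) :
    (∑ l : Fin T, C (a l) * X ^ (e l)).support.card ≤ T := by
  have h1 := card_support_sum_le (univ : Finset (Fin T)) (fun l => C (a l) * X ^ (e l))
  have h2 : ∑ l : Fin T, (C (a l) * X ^ (e l)).support.card ≤ ∑ _l : Fin T, (1 : ℕ) :=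
    Finset.sum_le_sum fun l _ => card_support_C_mul_X_pow_le_one
  rw [Finset.sum_const, Finset.card_univ, Fintype.card_fin, smul_eq_mul, mul_one] at h2
  exact h1.trans h2

/-- Block decomposition: a polynomial of `natDegree < k t` is the sum of `k` blocks of `t`
consecutive monomials each. -/
theorem sum_blocks_eq (P : ℝ[X]) (k t : ℕ) (h : P.natDegree < k * t) :
    (∑ i : Fin k, ∑ l : Fin t, C (P.coeff ((l : ℕ) + t * (i : ℕ))) * X ^ ((l : ℕ) + t * (i : ℕ)))
      = P := by
  calc (∑ i : Fin k, ∑ l : Fin t, C (P.coeff ((l : ℕ) + t * (i : ℕ))) * X ^ ((l : ℕ) + t * (i : ℕ)))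
      = ∑ x : Fin k × Fin t,
          C (P.coeff ((x.2 : ℕ) + t * (x.1 : ℕ))) * X ^ ((x.2 : ℕ) + t * (x.1 : ℕ)) :=
        (Fintype.sum_prod_type' _).symm
    _ = ∑ x : Fin k × Fin t,
          (fun n : Fin (k * t) => C (P.coeff (n : ℕ)) * X ^ (n : ℕ)) (finProdFinEquiv x) := rfl
    _ = ∑ n : Fin (k * t), C (P.coeff (n : ℕ)) * X ^ (n : ℕ) :=
        Equiv.sum_comp finProdFinEquiv (fun n : Fin (k * t) => C (P.coeff (n : ℕ)) * X ^ (n : ℕ))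
    _ = ∑ n ∈ range (k * t), C (P.coeff n) * X ^ n :=
        Fin.sum_univ_eq_sum_range (fun n => C (P.coeff n) * X ^ n) _
    _ = ∑ n ∈ range (k * t), monomial n (P.coeff n) :=
        Finset.sum_congr rfl fun n _ => C_mul_X_pow_eq_monomial
    _ = P := (as_sum_range' P _ h).symm

theorem card_support_block_le (P : ℝ[X]) (t i : ℕ) :
    (∑ l : Fin t, C (P.coeff ((l : ℕ) + t * i)) * X ^ ((l : ℕ) + t * i)).support.card ≤ t := by
  exact card_support_sum_CXpow_le t (fun l => P.coeff ((l : ℕ) + t * i)) (fun l => (l : ℕ) + t * i)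

/-- Tightness one step up: the body of `RealTauRefined` at exponent `a = 1` (bound
`2^(m+1) (k+t+2)`) is false — witness `m = 1`, `k = t = 12`, `F = ∏_{i<121} (X - i)` cut into 12
blocks of 12 monomials: `121 > 4 · 26 = 104` distinct real zeros.  So any witness exponent for the
crux is `≥ 2` (`a = 2` is not known to fail: every known ΣΠ-sparse family has `O(kmt)` real zeros). -/
theorem realTauRefined_bound_fails_at_one :
    ¬ ∀ (k m t : ℕ) (f : Fin k → Fin m → Polynomial ℝ),
      (∀ i j, (f i j).support.card ≤ t) → (∑ i, ∏ j, f i j) ≠ 0 →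
        (∑ i, ∏ j, f i j).roots.toFinset.card ≤ 2 ^ (1 * (m + 1)) * (k + t + 2) ^ 1 := by
  intro ha
  set s : Multiset ℝ := (Multiset.range 121).map ((↑) : ℕ → ℝ) with hs
  set P : Polynomial ℝ := (s.map fun r => X - C r).prod with hP
  have hnd : s.Nodup := (Multiset.nodup_range 121).map Nat.cast_injective
  have hsN : Multiset.card s = 121 := by rw [hs, Multiset.card_map, Multiset.card_range]
  have hcard : P.roots.toFinset.card = 121 := by
    rw [hP, roots_multiset_prod_X_sub_C, Multiset.toFinset_card_of_nodup hnd, hsN]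
  have hP0 : P ≠ 0 := by
    rw [hP]; exact (monic_multiset_prod_of_monic _ _ fun r _ => monic_X_sub_C r).ne_zero
  have hdeg : P.natDegree = 121 := by
    rw [hP, natDegree_multiset_prod_X_sub_C_eq_card, hsN]
  have key : (∑ i : Fin 12, ∏ _j : Fin 1,
      ∑ l : Fin 12, C (P.coeff ((l : ℕ) + 12 * (i : ℕ))) * X ^ ((l : ℕ) + 12 * (i : ℕ))) = P := by
    simp only [Finset.prod_const, Finset.card_univ, Fintype.card_fin, pow_one]
    exact sum_blocks_eq P 12 12 (by rw [hdeg]; norm_num)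
  have h := ha 12 1 12
    (fun i _ => ∑ l : Fin 12, C (P.coeff ((l : ℕ) + 12 * (i : ℕ))) * X ^ ((l : ℕ) + 12 * (i : ℕ)))
    (fun i _ => card_support_block_le P 12 i) (by rw [key]; exact hP0)
  rw [key, hcard] at h
  norm_num at h

/-- Summary of the two tightness lemmas: ANY witness exponent for the crux is at least `2`
(`a = 0`: `realTauRefined_bound_fails_at_zero`, Part I; `a = 1`: `realTauRefined_bound_fails_at_one`).
[folklore] -/
theorem two_le_of_realTauRefined_exponent (a : ℕ)
    (ha : ∀ (k m t : ℕ) (f : Fin k → Fin m → Polynomial ℝ),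
      (∀ i j, (f i j).support.card ≤ t) → (∑ i, ∏ j, f i j) ≠ 0 →
        (∑ i, ∏ j, f i j).roots.toFinset.card ≤ 2 ^ (a * (m + 1)) * (k + t + 2) ^ a) :
    2 ≤ a := by
  by_contra h
  interval_cases a
  · exact realTauRefined_bound_fails_at_zero ha
  · exact realTauRefined_bound_fails_at_one ha

/-! ### (g) natural strengthenings that are false -/

/-- Natural strengthening 1 is false: counting real zeros WITH MULTIPLICITY (`roots.card` in place
of `roots.toFinset.card`) dies on `X^N` (`k = m = t = 1`). (Hrubeš's Conj. 2.1 counts NONZERO roots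
with multiplicity and is equivalent to the crux; the root `0` must be excluded.) -/
theorem not_realTauRefined_withMultiplicity :
    ¬ ∃ a : ℕ, ∀ (k m t : ℕ) (f : Fin k → Fin m → Polynomial ℝ),
      (∀ i j, (f i j).support.card ≤ t) → (∑ i, ∏ j, f i j) ≠ 0 →
        Multiset.card (∑ i, ∏ j, f i j).roots ≤ 2 ^ (a * (m + 1)) * (k + t + 2) ^ a := by
  rintro ⟨a, ha⟩
  set N : ℕ := 2 ^ (a * (1 + 1)) * (1 + 1 + 2) ^ a + 1 with hN
  have key : (∑ _i : Fin 1, ∏ _j : Fin 1, C (1 : ℝ) * X ^ N) = X ^ N := by simp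
  have h := ha 1 1 1 (fun _ _ => C (1 : ℝ) * X ^ N) (fun _ _ => card_support_C_mul_X_pow_le_one)
    (by rw [key]; exact pow_ne_zero _ X_ne_zero)
  rw [key, roots_X_pow, Multiset.card_nsmul, Multiset.card_singleton, mul_one] at h
  omega

/-- Natural strengthening 2 is false: the statement over `ℂ` (all complex zeros) dies on `X^N - 1`
(`k = m = 1`, `t = 2`): the ORDER of `ℝ` is the whole content (route rationale). -/
theorem not_realTauRefined_complex :
    ¬ ∃ a : ℕ, ∀ (k m t : ℕ) (f : Fin k → Fin m → Polynomial ℂ),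
      (∀ i j, (f i j).support.card ≤ t) → (∑ i, ∏ j, f i j) ≠ 0 →
        (∑ i, ∏ j, f i j).roots.toFinset.card ≤ 2 ^ (a * (m + 1)) * (k + t + 2) ^ a := by
  rintro ⟨a, ha⟩
  set N : ℕ := 2 ^ (a * (1 + 1)) * (1 + 2 + 2) ^ a + 1 with hN
  have hN0 : N ≠ 0 := by omega
  have key : (∑ _i : Fin 1, ∏ _j : Fin 1, ((X : ℂ[X]) ^ N - C 1)) = X ^ N - C 1 := by simp
  have hroots : ((X : ℂ[X]) ^ N - C 1).roots.toFinset.card = N := by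
    have hprim := Complex.isPrimitiveRoot_exp N hN0
    have h1 : ((X : ℂ[X]) ^ N - C 1).roots = nthRoots N (1 : ℂ) := rfl
    rw [h1, Multiset.toFinset_card_of_nodup (IsPrimitiveRoot.nthRoots_one_nodup hprim),
      IsPrimitiveRoot.card_nthRoots_one hprim]
  have hsupp : ((X : ℂ[X]) ^ N - C 1).support.card ≤ 2 := by
    have h1 : ((X : ℂ[X]) ^ N - C 1) = C 1 * X ^ N + C (-1) * X ^ 0 := by
      simp [sub_eq_add_neg]
    rw [h1]
    calc _ ≤ (C (1 : ℂ) * X ^ N).support.card + (C (-1 : ℂ) * X ^ 0).support.card :=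
          (card_le_card support_add).trans (card_union_le _ _)
      _ ≤ 1 + 1 := Nat.add_le_add card_support_C_mul_X_pow_le_one card_support_C_mul_X_pow_le_one
  have h := ha 1 1 2 (fun _ _ => X ^ N - C 1) (fun _ _ => hsupp)
    (by rw [key]; exact X_pow_sub_C_ne_zero (by omega) 1)
  rw [key, hroots] at h
  omega

/-! ### (i) line `fischer-powers`: the open stub is the crux -/

/-! Remark (why the `2^{a(m+1)}` slack is exactly Fischer's price, so the line cannot do better): the
Waring rank of the monomial `y_1 ⋯ y_m` is `2^{m-1}` over `ℂ` (Carlini–Catalisano–Geramita, J. Algebra 370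
(2012) 5–14) and also over `ℝ`, so ANY rewriting of a product of `m` distinct sparse factors as a signed
sum of `m`-th powers of linear combinations of the factors needs `K ≥ 2^{m-1}` powers per product;
Fischer/Ryser's `2^m - 1` is optimal up to a factor 2.  Hence a Waring-form bound closes the crux in the
refined shape iff it is polynomial in `K` with an `m`-dependence at most `2^{O(m)}` — and the calibration
of §(k) says the truth in Waring form is plausibly `2KT - K - 1`, m-free. -/

/-- LINE `fischer-powers`: the crux implies the antecedent of `stub_fischer` (`EqualPowerSigned`)
with the SAME exponent — a signed sum of `K` `m`-th powers of `T`-sparse polynomials is a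
`(K, m, T)` ΣΠ-sparse expression (put the sign on the first factor). -/
theorem equalPowerSigned_of_realTauRefined (hR : RealTauRefined) :
    ∃ a : ℕ, ∀ (K m T : ℕ) (ε : Fin K → ℤˣ) (h : Fin K → Polynomial ℝ),
      (∀ i, (h i).support.card ≤ T) →
        (∑ i, C (((ε i : ℤ) : ℝ)) * h i ^ m) ≠ 0 →
          (∑ i, C (((ε i : ℤ) : ℝ)) * h i ^ m).roots.toFinset.card
            ≤ 2 ^ (a * (m + 1)) * (K + T + 2) ^ a := by
  obtain ⟨a, ha⟩ := hR
  refine ⟨a, fun K m T ε h hh hne => ?_⟩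
  rcases Nat.eq_zero_or_pos m with rfl | hm
  · have h0 : (∑ i, C (((ε i : ℤ) : ℝ)) * h i ^ 0) = C (∑ i, (((ε i : ℤ) : ℝ))) := by
      simp [map_sum]
    rw [h0, roots_C]
    simp
  · obtain ⟨n, rfl⟩ : ∃ n, m = n + 1 := ⟨m - 1, by omega⟩
    let f : Fin K → Fin (n + 1) → ℝ[X] := fun i => Fin.cons (C (((ε i : ℤ) : ℝ)) * h i) (fun _ => h i)
    have hprod : ∀ i, (∏ j, f i j) = C (((ε i : ℤ) : ℝ)) * h i ^ (n + 1) := by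
      intro i
      rw [Fin.prod_univ_succ]
      simp only [f, Fin.cons_zero, Fin.cons_succ, Finset.prod_const, Finset.card_univ,
        Fintype.card_fin]
      ring
    have hsum : (∑ i, ∏ j, f i j) = ∑ i, C (((ε i : ℤ) : ℝ)) * h i ^ (n + 1) :=
      Finset.sum_congr rfl fun i _ => hprod i
    have hfs : ∀ i j, (f i j).support.card ≤ T := by
      intro i j
      refine Fin.cases ?_ (fun j => ?_) j
      · simp only [f, Fin.cons_zero]
        rw [C_mul']
        exact (card_le_card (support_smul _ _)).trans (hh i)
      · simp only [f, Fin.cons_succ]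
        exact hh i
    have := ha K (n + 1) T f hfs (by rw [hsum]; exact hne)
    rwa [hsum] at this

/-- LINE `fischer-powers`: the crux implies the open stub `stub_waringOnCurve` verbatim (and even
without its `StrictMono e` hypothesis, which is therefore cosmetic) — with the line's two true
stubs, stub 1 is EQUIVALENT to the crux: the line is a normal-form redirect, not a reduction. -/
theorem waringOnCurve_of_realTauRefined (hR : RealTauRefined) :
    ∃ a : ℕ, ∀ (K m T : ℕ) (ε : Fin K → ℤˣ) (c : Fin K → Fin T → ℝ) (e : Fin T → ℕ),
      (∑ i, C (((ε i : ℤ) : ℝ)) * (∑ l, C (c i l) * X ^ (e l)) ^ m) ≠ 0 →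
        (∑ i, C (((ε i : ℤ) : ℝ)) * (∑ l, C (c i l) * X ^ (e l)) ^ m).roots.toFinset.card
          ≤ 2 ^ (a * (m + 1)) * (K + T + 2) ^ a := by
  obtain ⟨a, ha⟩ := equalPowerSigned_of_realTauRefined hR
  exact ⟨a, fun K m T ε c e hne =>
    ha K m T ε (fun i => ∑ l, C (c i l) * X ^ (e l)) (fun i => card_support_sum_CXpow_le T (c i) e) hne⟩

/-- The registered stub statement (with `StrictMono e`) follows. -/
theorem stub_waringOnCurve_of_realTauRefined (hR : RealTauRefined) :
    ∃ a : ℕ, ∀ (K m T : ℕ) (ε : Fin K → ℤˣ) (c : Fin K → Fin T → ℝ) (e : Fin T → ℕ), StrictMono e →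
      (∑ i, C (((ε i : ℤ) : ℝ)) * (∑ l, C (c i l) * X ^ (e l)) ^ m) ≠ 0 →
        (∑ i, C (((ε i : ℤ) : ℝ)) * (∑ l, C (c i l) * X ^ (e l)) ^ m).roots.toFinset.card
          ≤ 2 ^ (a * (m + 1)) * (K + T + 2) ^ a := by
  obtain ⟨a, ha⟩ := waringOnCurve_of_realTauRefined hR
  exact ⟨a, fun K m T ε c e _ hne => ha K m T ε c e hne⟩

/-- Lead's reshape r2 (2026-08-17, `Lines/fischer_powers.lean`): the open core is now `stub_waringLargeK`
(`K ≥ 3`); the crux implies it verbatim as well (drop the hypotheses `3 ≤ K` and `StrictMono e`), so the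
r2 open stub is again EQUIVALENT to the crux given the line's true stubs 1a, 2, 3. [folklore] -/
theorem stub_waringLargeK_of_realTauRefined (hR : RealTauRefined) :
    ∃ a : ℕ, ∀ (K m T : ℕ) (ε : Fin K → ℤˣ) (c : Fin K → Fin T → ℝ) (e : Fin T → ℕ), 3 ≤ K →
      StrictMono e →
      (∑ i, C (((ε i : ℤ) : ℝ)) * (∑ l, C (c i l) * X ^ (e l)) ^ m) ≠ 0 →
        (∑ i, C (((ε i : ℤ) : ℝ)) * (∑ l, C (c i l) * X ^ (e l)) ^ m).roots.toFinset.card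
          ≤ 2 ^ (a * (m + 1)) * (K + T + 2) ^ a := by
  obtain ⟨a, ha⟩ := waringOnCurve_of_realTauRefined hR
  exact ⟨a, fun K m T ε c e _ _ hne => ha K m T ε c e hne⟩

/-! ### (h) positive half-line normal form -/

/-- Positive-roots form of the crux: bound only the zeros in `(0, ∞)`. -/
def RealTauRefinedPos : Prop :=
  ∃ a : ℕ, ∀ (k m t : ℕ) (f : Fin k → Fin m → Polynomial ℝ), (∀ i j, (f i j).support.card ≤ t) →
    (∑ i, ∏ j, f i j) ≠ 0 →
      ((∑ i, ∏ j, f i j).roots.toFinset.filter (0 < ·)).card ≤ 2 ^ (a * (m + 1)) * (k + t + 2) ^ a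

/-- Negative zeros of `F` are positive zeros of `F(-X)`, which is again a `(k, m, t)` ΣΠ-sparse
expression. -/
theorem card_filter_neg_eq (F : ℝ[X]) :
    (F.roots.toFinset.filter (· < 0)).card = ((F.comp (-X)).roots.toFinset.filter (0 < ·)).card := by
  rw [roots_comp_neg_X]
  apply le_antisymm
  · refine card_le_card_of_injOn (fun x => -x) ?_ (fun x _ y _ h => neg_injective h)
    intro x hx
    simp only [coe_filter, Set.mem_setOf_eq, Multiset.mem_toFinset, Multiset.mem_map] at hx ⊢
    exact ⟨⟨x, hx.1, rfl⟩, neg_pos.mpr hx.2⟩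
  · refine card_le_card_of_injOn (fun x => -x) ?_ (fun x _ y _ h => neg_injective h)
    intro x hx
    simp only [coe_filter, Set.mem_setOf_eq, Multiset.mem_toFinset, Multiset.mem_map] at hx ⊢
    obtain ⟨⟨y, hy, rfl⟩, hx0⟩ := hx
    exact ⟨by simpa using hy, by linarith⟩

theorem realTauRefined_iff_pos : RealTauRefined ↔ RealTauRefinedPos := by
  constructor
  · rintro ⟨a, ha⟩
    exact ⟨a, fun k m t f hf hF => (card_filter_le _ _).trans (ha k m t f hf hF)⟩
  · rintro ⟨a, ha⟩
    refine ⟨a + 1, fun k m t f hf hF => ?_⟩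
    set F := ∑ i, ∏ j, f i j with hFdef
    set B := 2 ^ (a * (m + 1)) * (k + t + 2) ^ a with hB
    -- positive zeros
    have hpos : (F.roots.toFinset.filter (0 < ·)).card ≤ B := ha k m t f hf hF
    -- negative zeros, via F(-X) = ∑ ∏ f i j (-X)
    have hcomp : F.comp (-X) = ∑ i, ∏ j, (f i j).comp (-X) := by
      rw [hFdef, ← coe_compRingHom_apply, map_sum]
      refine Finset.sum_congr rfl fun i _ => ?_
      rw [map_prod]
      rfl
    have hF' : (∑ i, ∏ j, (f i j).comp (-X)) ≠ 0 := by
      rw [← hcomp]; exact fun h => hF (comp_neg_X_eq_zero_iff.mp h)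
    have hneg : (F.roots.toFinset.filter (· < 0)).card ≤ B := by
      rw [card_filter_neg_eq, hcomp]
      exact ha k m t (fun i j => (f i j).comp (-X)) (fun i j => by rw [support_comp_neg_X]; exact hf i j) hF'
    -- zero
    have hsplit : F.roots.toFinset ⊆
        insert 0 (F.roots.toFinset.filter (· < 0) ∪ F.roots.toFinset.filter (0 < ·)) := by
      intro x hx
      rcases lt_trichotomy x 0 with h | h | h
      · exact mem_insert_of_mem (mem_union_left _ (mem_filter.mpr ⟨hx, h⟩))
      · simp [h]
      · exact mem_insert_of_mem (mem_union_right _ (mem_filter.mpr ⟨hx, h⟩))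
    have hB1 : 1 ≤ B := by rw [hB]; exact Nat.one_le_iff_ne_zero.mpr (by positivity)
    have h2 : 2 ≤ k + t + 2 := by omega
    calc F.roots.toFinset.card
        ≤ (insert (0 : ℝ) (F.roots.toFinset.filter (· < 0) ∪ F.roots.toFinset.filter (0 < ·))).card :=
          card_le_card hsplit
      _ ≤ (F.roots.toFinset.filter (· < 0) ∪ F.roots.toFinset.filter (0 < ·)).card + 1 :=
          card_insert_le _ _
      _ ≤ B + B + 1 := by
          have := card_union_le (F.roots.toFinset.filter (· < 0)) (F.roots.toFinset.filter (0 < ·))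
          omega
      _ ≤ 2 ^ (m + 1) * (k + t + 2) * B := by
          have h4 : 4 * B ≤ 2 ^ (m + 1) * (k + t + 2) * B :=
            Nat.mul_le_mul_right B (by
              calc 4 = 2 * 2 := by norm_num
                _ ≤ 2 ^ (m + 1) * (k + t + 2) :=
                  Nat.mul_le_mul (by
                    calc 2 = 2 ^ 1 := by norm_num
                      _ ≤ 2 ^ (m + 1) := Nat.pow_le_pow_right (by norm_num) (by omega)) h2)
          omega
      _ = 2 ^ ((a + 1) * (m + 1)) * (k + t + 2) ^ (a + 1) := by
          rw [hB]; ring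


/-! ### (k) the additive count: where the true bound plausibly sits (conjecture + matching lower bound) -/

/-- THE ADDITIVE COUNT (calibration conjecture made precise by this seat; the folklore "linear in kmt"
guess, Koiran 2011 §6 / KPT15 §1, in sharp form): a nonzero `(k, m, t)` expression has at most
`k·m·(t-1) + k - 1` zeros in `(0, ∞)` — every sparse factor contributes its own Descartes budget `t - 1`,
every further summand one more.  Sharp at `m = 1` (Descartes) and `k = 1` (Koiran), consistent with
`f² - g² = (f-g)(f+g)` (`4t - 3` on both sides), and ATTAINED for all `k, m ≥ 1, t ≥ 2` by the
scale-separation family of `AdditiveCountAttained` below; every numerical maximum of §(j) is `≤` it, with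
equality wherever the search is strong (`(2,m,2)`: `2m+1`; `fg+1`: `2t-1`; `fgh+1`: `3t-2`; `(3,2,2)`: 8;
`(2,2,3)`: 9).  OPEN even for `(k,m,t) = (2,2,2)` (5 vs Descartes' 7) and for `fg + 1`, `t = 3` (5 vs 9). -/
def AdditiveCount : Prop :=
  ∀ (k m t : ℕ) (f : Fin k → Fin m → Polynomial ℝ), (∀ i j, (f i j).support.card ≤ t) →
    (∑ i, ∏ j, f i j) ≠ 0 →
      ((∑ i, ∏ j, f i j).roots.toFinset.filter (0 < ·)).card ≤ k * m * (t - 1) + k - 1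

/-- Any bound `B k m t` on the POSITIVE zeros of `(k,m,t)` expressions bounds all real zeros by
`2 B + 1`. -/
theorem card_roots_le_of_pos_bound (B : ℕ → ℕ → ℕ → ℕ)
    (hB : ∀ (k m t : ℕ) (f : Fin k → Fin m → Polynomial ℝ), (∀ i j, (f i j).support.card ≤ t) →
      (∑ i, ∏ j, f i j) ≠ 0 → ((∑ i, ∏ j, f i j).roots.toFinset.filter (0 < ·)).card ≤ B k m t)
    (k m t : ℕ) (f : Fin k → Fin m → Polynomial ℝ) (hf : ∀ i j, (f i j).support.card ≤ t)
    (hF : (∑ i, ∏ j, f i j) ≠ 0) :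
    (∑ i, ∏ j, f i j).roots.toFinset.card ≤ 2 * B k m t + 1 := by
  set F := ∑ i, ∏ j, f i j with hFdef
  have hpos : (F.roots.toFinset.filter (0 < ·)).card ≤ B k m t := hB k m t f hf hF
  have hcomp : F.comp (-X) = ∑ i, ∏ j, (f i j).comp (-X) := by
    rw [hFdef, ← coe_compRingHom_apply, map_sum]
    refine Finset.sum_congr rfl fun i _ => ?_
    rw [map_prod]
    rfl
  have hF' : (∑ i, ∏ j, (f i j).comp (-X)) ≠ 0 := by
    rw [← hcomp]; exact fun h => hF (comp_neg_X_eq_zero_iff.mp h)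
  have hneg : (F.roots.toFinset.filter (· < 0)).card ≤ B k m t := by
    rw [card_filter_neg_eq, hcomp]
    exact hB k m t (fun i j => (f i j).comp (-X)) (fun i j => by rw [support_comp_neg_X]; exact hf i j) hF'
  have hsplit : F.roots.toFinset ⊆
      insert 0 (F.roots.toFinset.filter (· < 0) ∪ F.roots.toFinset.filter (0 < ·)) := by
    intro x hx
    rcases lt_trichotomy x 0 with h | h | h
    · exact mem_insert_of_mem (mem_union_left _ (mem_filter.mpr ⟨hx, h⟩))
    · simp [h]
    · exact mem_insert_of_mem (mem_union_right _ (mem_filter.mpr ⟨hx, h⟩))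
  calc F.roots.toFinset.card
      ≤ (insert (0 : ℝ) (F.roots.toFinset.filter (· < 0) ∪ F.roots.toFinset.filter (0 < ·))).card :=
        card_le_card hsplit
    _ ≤ (F.roots.toFinset.filter (· < 0) ∪ F.roots.toFinset.filter (0 < ·)).card + 1 :=
        card_insert_le _ _
    _ ≤ 2 * B k m t + 1 := by
        have := card_union_le (F.roots.toFinset.filter (· < 0)) (F.roots.toFinset.filter (0 < ·))
        omega

/-- The additive count implies the crux with `a = 2`. -/
theorem realTauRefined_of_additiveCount (h : AdditiveCount) : RealTauRefined := by
  refine ⟨2, fun k m t f hf hF => (card_roots_le_of_pos_bound (fun k m t => k * m * (t - 1) + k - 1)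
    h k m t f hf hF).trans ?_⟩
  -- 2 (k m (t-1) + k - 1) + 1 ≤ 2^(2(m+1)) (k+t+2)^2
  have hA : k * m * (t - 1) ≤ k * m * (t + 2) := Nat.mul_le_mul_left _ (by omega)
  have hk1 : 1 ≤ k := by
    rcases Nat.eq_zero_or_pos k with rfl | hk
    · exact absurd (by simp) hF
    · exact hk
  have h1 : 2 * (k * m * (t - 1) + k - 1) + 1 ≤ 2 * (k * (m + 1) * (t + 2)) := by
    have hB : k ≤ k * (t + 2) := Nat.le_mul_of_pos_right k (by omega)
    have : k * (m + 1) * (t + 2) = k * m * (t + 2) + k * (t + 2) := by ring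
    omega
  have h2 : 2 * (m + 1) ≤ 2 ^ (2 * (m + 1)) := by
    calc 2 * (m + 1) ≤ 2 ^ (m + 1) := by
          calc 2 * (m + 1) = (m + 1) + (m + 1) := by ring
            _ ≤ 2 ^ m + 2 ^ m := Nat.add_le_add (Nat.succ_le_of_lt Nat.lt_two_pow_self)
                (Nat.succ_le_of_lt Nat.lt_two_pow_self)
            _ = 2 ^ (m + 1) := by rw [pow_succ]; ring
      _ ≤ 2 ^ (2 * (m + 1)) := Nat.pow_le_pow_right (by norm_num) (by omega)
  have h3 : k * (t + 2) ≤ (k + t + 2) ^ 2 := by nlinarith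
  calc 2 * (k * m * (t - 1) + k - 1) + 1 ≤ 2 * (k * (m + 1) * (t + 2)) := h1
    _ = (2 * (m + 1)) * (k * (t + 2)) := by ring
    _ ≤ 2 ^ (2 * (m + 1)) * (k + t + 2) ^ 2 := Nat.mul_le_mul h2 h3

/-- THE ADDITIVE COUNT IS ATTAINED (proposition, proved on paper by this seat — scale separation; the
general case is not formalised (dominance estimates + IVT), the instance `(2,2,2)` IS:
`additiveCount_attained_2_2_2` below).  For `k, m ≥ 1`, `t ≥ 2` there is a nonzero `(k,m,t)`
expression with `≥ k m (t-1) + k - 1` distinct zeros in `(0,∞)`.  CONSTRUCTION: fix a monic `t`-nomial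
`q` of degree `t - 1` with `t - 1` simple zeros in `[1, 2]`.  Put `P_i(x) = c_i x^{A i} ∏_{j<m} q(x / (S^i 2^j))`
(the monomial `c_i x^{A i}` absorbed into the first factor), with `A > m(t-1)` and `S = e^G`, `G` large.
In `u = log x`, `log|P_i(e^u)| = log|c_i| + A i u + Σ_j ρ(u - iG - j log 2)` where `ρ(v) = log|q(e^v)|` is
`≈ log|q(0)|` for `v ≪ 0` and `≈ (t-1) v` for `v ≫ 0`; the `m(t-1)` zeros of `P_i` are distinct and lie in the
window `W_i = [iG, iG + m log 2]`.  Choosing `log|c_i|` so that the lines `log|c_i| + A i u` cross midway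
between consecutive windows, and `G ≫ A, m, t`, gives `|P_l| ≤ e^{-M} |P_i|_{env}` on `W_i` for `l ≠ i` with
`M → ∞` as `G → ∞`, while at the local extrema of `P_i` between its consecutive zeros `|P_i| ≥ δ |P_i|_{env}`
with `δ = δ(q, m) > 0` independent of `G`.  Hence `F = Σ_i P_i` has the sign of `P_i` at those extrema:
`m(t-1)` sign changes inside each `W_i`; between `W_i` and `W_{i+1}` only `P_i, P_{i+1}` matter, both
zero-free there, `|P_i/P_{i+1}|` is strictly monotone (slope `A i + m(t-1) - A(i+1) < 0`), so choosing
`sign c_{i+1} = -(sign c_i)·(sign q(0))^m` adds exactly one zero per gap: total `k m (t-1) + (k - 1)`.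
(With `q` even in `x`, the same count appears on `(-∞, 0)`: `2 k m (t-1) + O(k)` real zeros — so any valid
bound in the crux is `Ω(kmt)`, trilinear; the refined shape `2^{a(m+1)}(k+t+2)^a` absorbs this at `a = 2`.) -/
/-  Exact check of the construction (this seat, rational arithmetic, geometric grid of ratio 6/5):
    `(k,m,t) = (2,m,2)`, `P_1 = ∏_{j<m} (x - 2^j)`, `P_2 = ± x^{m+3} ∏_{j<m} (x - S 2^j) / D` with
    `S = 10^{⌈0.1·(m(m+3) + m²/2)⌉ + 3}`, `D = √(2^{m(m+3)+m²/2} S^m · S^{m+3})`: sign changes of `P_1 + P_2`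
    found = 5, 7, 9, 11, 13, 17 for m = 2, 3, 4, 5, 6, 8 with the right sign of `P_2` (= `2m + 1`, the additive
    count; the other sign loses exactly the gap zero: 4, 6, 8, 10, 12, 16) — versus Descartes 7 … 511. -/
def AdditiveCountAttained : Prop :=
  ∀ (k m t : ℕ), 1 ≤ k → 1 ≤ m → 2 ≤ t → ∃ f : Fin k → Fin m → Polynomial ℝ,
    (∀ i j, (f i j).support.card ≤ t) ∧ (∑ i, ∏ j, f i j) ≠ 0 ∧
      k * m * (t - 1) + k - 1 ≤ ((∑ i, ∏ j, f i j).roots.toFinset.filter (0 < ·)).card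

/-! WARING CALIBRATION (for the lead's `stub_waringOnCurve` / `stub_waringLargeK`; same scale-separation
analysis, CORRECTED after the odd-`m` probe j024175).  Write `G = Σ_{i<K} ε_i h_i^m`, `h_i` `T`-sparse.
* EVEN `m` (every term has the fixed sign `ε_i`): with the `h_i` dominant on pairwise separated scales, each of
  the `T - 1` positive zeros of `h_i` is a double-touch of `ε_i h_i^m` that splits into two simple zeros of `G`
  exactly when the locally constant-sign remainder has sign `-ε_i`; alternating `ε` achieves this in every
  window and each gap adds one crossing: `Z₊(G) ≥ 2K(T-1) + (K-1) = 2KT - K - 1` for every even `m`.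
  EXPLICIT m-UNIFORM FAMILY (exact rational arithmetic, and on paper for every even `m ≥ 2` by comparing
  dominant bases at each point): `G_m = -(x-1)^m + (x²(x-100)/10³)^m - (x⁶(x-10⁴)/10¹⁶)^m` (`K = 3`,
  `T = 2`) has the sign pattern `- + - + - + - + -` at `x = 1/2, 1, 3/2, 20, 100, 120, 8000, 10⁴, 1.2·10⁴`,
  hence `≥ 8` distinct positive zeros for EVERY even `m` (kernel-checked at `m = 2`:
  `waringCount_attained_3_2_2`).  The searches found exactly `2KT - K - 1` for `T = 2` (`K = 3`: 8;
  `K = 4`: 11) at every even `m ≤ 12`, never more.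
* ODD `m` (signs absorbed: `G = Σ g_i^m`, `g_i = ±h_i`): each simple zero of `g_i` gives one zero of `G` in
  its window, but for larger `m` the zeros of `G` migrate to the sign-changing breakpoints of the upper
  envelope `max_i |g_i|` (pairwise ties `g_i = -g_j`, each a `2T`-nomial equation), and the probe j024175
  found `Z₊ = 7` at `m = 3` and `9` at `m = 5` for `K = 3, T = 2` — MORE than the even-`m` count 8.  So the
  tidy guess "`Z₊ ≤ 2KT - K - 1` for all `m`" is FALSE (9 > 8 at `(K,T,m) = (3,2,5)`); what survives is
  m-freeness in the weak sense of KPT15 Thm. 12 (for fixed `K, T` the count is bounded in `m`) with a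
  constant that the data put at `O(K² T)` at worst (pairwise envelope ties) — still polynomial, which via
  Fischer (`K = k 2^m`, `T = m t`) is all the refined shape needs.
* In PRODUCT form every Waring datum stays far below the additive count `k m (t-1) + k - 1` (e.g. `9 ≤ 17`
  at `(3,5,2)`), so §(k)'s calibration conjecture is untouched by the odd-`m` phenomenon.
KPT15 Thm. 12 proves m-freeness with an `exp(O(K³ log T))` constant; the only printed lower-bound family,
KPT15 Thm. 25 (arXiv:1205.1015 §6, read this session: `g = h ∘ f`, `h(y) = y ∏_{i<K}(y² - i²)` `K`-sparse,
`f` dense with `d` real zeros, so `g = Σ_i a_i f^{α_i}` is a Waring-type sum with `T = d + 1` and DISTINCT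
odd exponents), has `(2K-1)(T-1)` zeros — linear in `KT`, consistent with all of the above. -/

/-- SIGN-ALTERNATION CERTIFICATE: if `F.eval` takes values of opposite signs at consecutive points of an
increasing list `x₀ < x₁ < ⋯ < xₙ` of positive reals, then `F` has at least `n` distinct zeros in `(0,∞)`
(IVT on each `[xᵢ, xᵢ₊₁]`; consecutive zeros are separated by the `xᵢ`). [folklore] -/
theorem le_card_pos_roots_of_alternating (F : ℝ[X]) {n : ℕ} (x : Fin (n + 1) → ℝ)
    (hx : StrictMono x) (h0 : 0 < x 0)
    (halt : ∀ i : Fin n, F.eval (x i.castSucc) * F.eval (x i.succ) < 0) :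
    n ≤ (F.roots.toFinset.filter (0 < ·)).card := by
  rcases Nat.eq_zero_or_pos n with rfl | hn
  · exact Nat.zero_le _
  have hF0 : F ≠ 0 := by
    intro h
    have := halt ⟨0, hn⟩
    rw [h, eval_zero, eval_zero, mul_zero] at this
    exact lt_irrefl _ this
  have hroot : ∀ i : Fin n, ∃ r, x i.castSucc < r ∧ r < x i.succ ∧ F.eval r = 0 := by
    intro i
    have hab : x i.castSucc ≤ x i.succ := (hx Fin.castSucc_lt_succ).le
    rcases mul_neg_iff.mp (halt i) with ⟨ha, hb⟩ | ⟨ha, hb⟩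
    · obtain ⟨r, ⟨hr1, hr2⟩, hr⟩ := intermediate_value_Ioo' hab F.continuous.continuousOn
        (show (0 : ℝ) ∈ Set.Ioo _ _ from ⟨hb, ha⟩)
      exact ⟨r, hr1, hr2, hr⟩
    · obtain ⟨r, ⟨hr1, hr2⟩, hr⟩ := intermediate_value_Ioo hab F.continuous.continuousOn
        (show (0 : ℝ) ∈ Set.Ioo _ _ from ⟨ha, hb⟩)
      exact ⟨r, hr1, hr2, hr⟩
  choose r hr1 hr2 hr0 using hroot
  have hlt : ∀ i j : Fin n, i < j → r i < r j := fun i j hij =>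
    calc r i < x i.succ := hr2 i
      _ ≤ x j.castSucc := hx.monotone (by
          rw [Fin.le_iff_val_le_val, Fin.val_succ, Fin.val_castSucc]
          exact Fin.lt_def.mp hij)
      _ < r j := hr1 j
  have hinj : Function.Injective r := fun i j h => by
    rcases lt_trichotomy i j with hij | hij | hij
    · exact absurd h (hlt i j hij).ne
    · exact hij
    · exact absurd h (hlt j i hij).ne'
  have hsub : Finset.univ.image r ⊆ F.roots.toFinset.filter (0 < ·) := by
    intro y hy
    obtain ⟨i, -, rfl⟩ := Finset.mem_image.mp hy
    refine mem_filter.mpr ⟨Multiset.mem_toFinset.mpr ((mem_roots hF0).mpr (IsRoot.def.mpr (hr0 i))), ?_⟩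
    exact h0.trans_le ((hx.monotone (Fin.zero_le _)).trans (hr1 i).le)
  calc n = (Finset.univ.image r).card := by
        rw [Finset.card_image_of_injective _ hinj, Finset.card_univ, Fintype.card_fin]
    _ ≤ _ := card_le_card hsub

/-- A binomial written as `C a * X ^ p + C b * X ^ q` has at most two monomials. [folklore] -/
theorem card_support_binom_le (a b : ℝ) (p q : ℕ) :
    (C a * X ^ p + C b * X ^ q).support.card ≤ 2 :=
  (card_le_card support_add).trans ((card_union_le _ _).trans
    (Nat.add_le_add card_support_C_mul_X_pow_le_one card_support_C_mul_X_pow_le_one))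

/-- THE ADDITIVE COUNT IS ATTAINED AT `(k,m,t) = (2,2,2)` (kernel-checked instance of the scale-separation
construction): a sum of two products of two real binomials with `5 = k m (t-1) + k - 1` distinct POSITIVE
zeros — Descartes allows 7, each product alone has 2, so the zeros of a sum of products EXCEED the sum of
the zeros of the products (the interaction term `k - 1` is real; numerically 5 is also the maximum found,
kit j023898/j024072).  Witness `F = 10¹²(X-1)(X-2) - X⁴(X-10⁴)(X-2·10⁴)`: products dominant on separated
scales, sign pattern `+ - + - + -` at `x = 1/2, 3/2, 3, 100, 15000, 30000`. [folklore] -/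
theorem additiveCount_attained_2_2_2 : ∃ f : Fin 2 → Fin 2 → Polynomial ℝ,
    (∀ i j, (f i j).support.card ≤ 2) ∧ (∑ i, ∏ j, f i j) ≠ 0 ∧
      5 ≤ ((∑ i, ∏ j, f i j).roots.toFinset.filter (0 < ·)).card := by
  let W : Fin 2 → Fin 2 → ℝ[X] :=
    ![![C ((10 : ℝ) ^ 12) * X ^ 1 + C (-(10 : ℝ) ^ 12) * X ^ 0, C 1 * X ^ 1 + C (-2) * X ^ 0],
      ![C (-1) * X ^ 5 + C 10000 * X ^ 4, C 1 * X ^ 1 + C (-20000) * X ^ 0]]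
  have hsparse : ∀ i j, (W i j).support.card ≤ 2 := by
    intro i j
    fin_cases i <;> fin_cases j <;> exact card_support_binom_le _ _ _ _
  have heval : ∀ x : ℝ, (∑ i, ∏ j, W i j).eval x =
      ((10 : ℝ) ^ 12 * x - 10 ^ 12) * (x - 2) + (-x ^ 5 + 10000 * x ^ 4) * (x - 20000) := by
    intro x
    simp [W, Fin.sum_univ_two, Fin.prod_univ_two]
    ring
  refine ⟨W, hsparse, ?_, ?_⟩
  · intro h
    have := heval (1 / 2)
    rw [h, eval_zero] at this
    norm_num at this
  · refine le_card_pos_roots_of_alternating _ ![1 / 2, 3 / 2, 3, 100, 15000, 30000] ?_ (by norm_num) ?_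
    · refine Fin.strictMono_iff_lt_succ.mpr fun i => ?_
      fin_cases i <;> simp <;> norm_num
    · intro i
      rw [heval, heval]
      fin_cases i <;> simp <;> norm_num

/-- THE WARING COUNT `2KT - K - 1` IS ATTAINED AT `(K, T, m) = (3, 2, 2)` (kernel-checked base case of the
m-uniform family `G_m = -(x-1)^m + (x²(x-100)/10³)^m - (x⁶(x-10⁴)/10¹⁶)^m` of `Disproof.lean` §(k), scaled by
`10³²`): `G = -(10¹⁶(X-1))² + (10¹³X³ - 10¹⁵X²)² - (X⁷ - 10⁴X⁶)²`, a sum of three signed squares of binomials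
(a `(3,2,2)` expression), has `≥ 8` distinct positive zeros — sign pattern `- + - + - + - + -` at
`x = 1/2, 1, 3/2, 20, 100, 120, 8000, 10⁴, 1.2·10⁴`; 8 is also Descartes' cap here and the maximum found
numerically for every even `m ≤ 12` (kit j023901). [folklore] -/
theorem waringCount_attained_3_2_2 : ∃ f : Fin 3 → Fin 2 → Polynomial ℝ,
    (∀ i j, (f i j).support.card ≤ 2) ∧ (∑ i, ∏ j, f i j) ≠ 0 ∧
      8 ≤ ((∑ i, ∏ j, f i j).roots.toFinset.filter (0 < ·)).card := by
  let W : Fin 3 → Fin 2 → ℝ[X] :=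
    ![![C (-(10 : ℝ) ^ 16) * X ^ 1 + C ((10 : ℝ) ^ 16) * X ^ 0, C ((10 : ℝ) ^ 16) * X ^ 1 + C (-(10 : ℝ) ^ 16) * X ^ 0],
      ![C ((10 : ℝ) ^ 13) * X ^ 3 + C (-(10 : ℝ) ^ 15) * X ^ 2, C ((10 : ℝ) ^ 13) * X ^ 3 + C (-(10 : ℝ) ^ 15) * X ^ 2],
      ![C (-1) * X ^ 7 + C 10000 * X ^ 6, C 1 * X ^ 7 + C (-10000) * X ^ 6]]
  have hsparse : ∀ i j, (W i j).support.card ≤ 2 := by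
    intro i j
    fin_cases i <;> fin_cases j <;> exact card_support_binom_le _ _ _ _
  have heval : ∀ x : ℝ, (∑ i, ∏ j, W i j).eval x =
      -((10 : ℝ) ^ 16 * x - 10 ^ 16) ^ 2 + (10 ^ 13 * x ^ 3 - 10 ^ 15 * x ^ 2) ^ 2
        - (x ^ 7 - 10000 * x ^ 6) ^ 2 := by
    intro x
    simp [W, Fin.sum_univ_three, Fin.prod_univ_two]
    ring
  refine ⟨W, hsparse, ?_, ?_⟩
  · intro h
    have := heval 1
    rw [h, eval_zero] at this
    norm_num at this
  · refine le_card_pos_roots_of_alternating _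
      ![1 / 2, 1, 3 / 2, 20, 100, 120, 8000, 10000, 12000] ?_ (by norm_num) ?_
    · refine Fin.strictMono_iff_lt_succ.mpr fun i => ?_
      fin_cases i <;> simp <;> norm_num
    · intro i
      rw [heval, heval]
      fin_cases i <;> simp <;> norm_num

/-! ### (j) calibration searches (numerical; kit jobs j023898, j023899, j023901, j024061, j024072, j024175)

Method: `F(e^u)` evaluated in signed log-space on a grid of 8001 points of
`[-40, 40]`, hill-climbing over exponents `≤ 40` (or `60`) and log-coefficients `|a| ≤ 25` maximising the
number of sign changes (a lower bound on the number of positive zeros), many random restarts, every record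
re-counted at 60 digits on 16001 points.  Caveat (Why-it-resists §3): exact-cancellation designs are
invisible to this method by construction (near-identically-vanishing configurations are discarded).

RESULTS (jobs j023898 = A, j023899 = B, j023901 = C; `best` = max number of sign changes of `F(e^u)` found =
certified lower bound on the number of POSITIVE zeros, re-verified at 60 digits (`mp60`, identical in every
row, 0 unreliable points); `Desc` = Descartes cap `k t^m - 1` on positive zeros (`K·C(m+T-1,T-1) - 1` in
Waring form); `lin` = `k m (t-1) + k - 1`; evaluations per case 0.8–8 × 10^5; rep-bests agree across seeds):

  products, k = 2 (A)      t = 2:  m = 2, 3, 4, 6, 8   → best 5, 7, 9, 13, 16   (Desc 7, 15, 31, 127, 511)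
                           t = 3:  m = 2, 3, 4, 5      → best 9, 12, 15, 16      (Desc 17, 53, 161, 485)
                           t = 4:  m = 2, 3            → best 11, 15             (Desc 31, 127)
  products, k = 3 (A)      (m,t) = (2,2), (3,2), (2,3) → best 8, 10, 11          (Desc 11, 23, 26)
  f g + 1 (B)              t = 2, 3, 4                 → best 3, 5, 7  = 2t - 1  (Desc 4, 9, 16)
  f g h + 1 (B)            t = 2, 3                    → best 4, 7     = 3(t-1)+1 (Desc 8, 27)
  Waring Σ_{i<K} ε_i h_i^m (C), positive zeros:
     K = 3, T = 2:  m = 2, 4, 8, 12 → 8, 8, 8, 8      (Desc 8, 14, 26, 38)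
     K = 3, T = 3:  m = 2, 4, 8     → 12, 12, 12      (Desc 17, 44, 134)
     K = 4, T = 2:  m = 2, 4, 8     → 11, 11, 11      (Desc 11, 19, 35)
     K = 4, T = 3:  m = 2, 4        → 15, 13          (Desc 23, 59)
     SOS-type K = 3, m = 2:  T = 4, 5 → 14, 15        (Desc 29, 44)
  optimiser calibration (B): k=1,m=3,t=3 → 6 = known max m(t-1); k=2,m=1,t=3 → 5 = Descartes-sharp;
     k=2,m=1,t=5 → 8 of 9 (the search loses about one zero at 10-term Descartes-sharp targets).
  DEEP RUNS (6× budget, 0.75–1.8 × 10^6 evaluations per case; D = j024061, E = j024072):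
     fg+1, t = 3 → 5 (D) ; fg+1, t = 4 → 7 (E) ; (2,2,2) → 5 (E) ; (2,2,3) → 9 (E) ; (3,2,2) → 8 (E) ;
     (2,3,3) → 13 (D; = additive count 4m+1, up from 12) ; (2,4,3) → 15 (D; additive 17) ;
     Waring K3 T3 m2 → 13 (D; even-m Waring count 14).  Every deep run SATURATES AT the additive count
     `k m (t-1) + k - 1` (resp. the even-m Waring count `2KT - K - 1`) or stays below it; none exceeds it.
  ODD-m AND WIDE-RANGE PROBES (F = j024175; |log coeff| ≤ 45, exponents ≤ 60 in the "wide" rows):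
     Waring K3 T2, m = 3 → 7 ; m = 5 → 9 (> 8: odd m beats the even-m count, see the Waring calibration
     block of §(k)) ; Waring K3 T3 m2 wide → 11 ; K4 T3 m2 wide → 15 ; (2,2,3) wide → 9 (= additive) ;
     (3,2,3) wide → 11 (additive 14) — the wider range did not help the hill-climber.

READING.  (1) Sums of two products: the count grows LINEARLY in m at fixed t (t = 2: exactly 2m + 1 up to
m = 6), and roughly like (t-1)-per-factor-plus-constant in t; nothing approaches Descartes.  (2) f g + 1 with
t-nomials: 2t - 1 = Z₊(f) + Z₊(g) + 1 — the ADDITIVE count, not t² (Descartes) and below the "≈ 7 at t = 3"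
the 2001 seat expected; f g h + 1: 3(t-1) + 1, additive again.  (3) Waring form: for EVEN m the maximum found is
INDEPENDENT of m (attained already at m = 2, where it is Descartes-sharp for T = 2); for ODD m it creeps up
(K3T2: 7 at m = 3, 9 at m = 5, job F) towards the envelope-tie count — numerically the line's open stub still
looks true in the stronger m-free form `Z ≤ poly(K,T)` (KPT15 Thm 12 proves m-freeness with an
exp(K³ log T) constant); the 2^{a(m+1)} slack of the crux is consumed by Fischer's k·2^m terms, not by zeros.  (4) Caveat: a hill-climber certifies lower bounds only; its power fades at ≳ 10 zeros (calibration
row 3), so rows with Desc ≫ 20 say "no easy configuration", not "no configuration".  No row is within a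
factor 2 of Descartes beyond the trivially sharp small cases; no super-linear growth in m or t was seen
anywhere.  Nothing here bears on the crux's truth directly (Why-it-resists §4); it calibrates where the
true bound plausibly sits: Θ(kmt).
-/


/-! ## Part III — cdisprove gen 2, cycle 1 -/

/-! ### (l) load-bearing square completed: `t` must enter the bound -/

/-- `RealTauRefined` with `t` dropped from the base: a bound in `k, m` alone. -/
def RealTauRefinedWithoutT : Prop :=
  ∃ a : ℕ, ∀ (k m t : ℕ) (f : Fin k → Fin m → Polynomial ℝ), (∀ i j, (f i j).support.card ≤ t) →
    (∑ i, ∏ j, f i j) ≠ 0 → (∑ i, ∏ j, f i j).roots.toFinset.card ≤ 2 ^ (a * (m + 1)) * (k + 2) ^ a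

/-- Any proof must let the bound grow with `t`: one `t`-sparse polynomial `∏_{i<N} (X - i)`
(`k = m = 1`, `t = N + 1`, `N = 12^a + 1`) has `N` distinct real zeros. [folklore] -/
theorem realTauRefined_false_without_t : ¬ RealTauRefinedWithoutT := by
  rintro ⟨a, ha⟩
  set N : ℕ := 2 ^ (a * (1 + 1)) * (1 + 2) ^ a + 1 with hN
  set s : Multiset ℝ := (Multiset.range N).map ((↑) : ℕ → ℝ) with hs
  set P : Polynomial ℝ := (s.map fun r => X - C r).prod with hP
  have hnd : s.Nodup := (Multiset.nodup_range N).map Nat.cast_injective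
  have hsN : Multiset.card s = N := by rw [hs, Multiset.card_map, Multiset.card_range]
  have hcard : P.roots.toFinset.card = N := by
    rw [hP, roots_multiset_prod_X_sub_C, Multiset.toFinset_card_of_nodup hnd, hsN]
  have hP0 : P ≠ 0 := by
    rw [hP]; exact (monic_multiset_prod_of_monic _ _ fun r _ => monic_X_sub_C r).ne_zero
  have hdeg : P.natDegree = N := by
    rw [hP, natDegree_multiset_prod_X_sub_C_eq_card, hsN]
  have hsupp : P.support.card ≤ N + 1 := (card_supp_le_succ_natDegree P).trans (by rw [hdeg])
  have key : (∑ _i : Fin 1, ∏ _j : Fin 1, P) = P := by simp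
  have h := ha 1 1 (N + 1) (fun _ _ => P) (fun _ _ => hsupp) (by rw [key]; exact hP0)
  rw [key, hcard] at h
  omega

/-! ### (m) the additive count is attained on its two Descartes faces (all parameters) -/

/-- Face `m = 1` of `AdditiveCountAttained`, for ALL `k, t ≥ 1` (Descartes sharpness in the crux's own
format): `∏_{i<kt-1} (X - (i+1))`, cut into `k` blocks of `t` consecutive monomials, is a sum of `k`
products of one `t`-sparse polynomial with `k t - 1 = k·1·(t-1) + k - 1` distinct zeros in `(0,∞)`.
Hence any valid bound in the crux is `≥ k t - 1` at `m = 1`. [folklore] -/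
theorem additiveCount_attained_m_one (k t : ℕ) (hk : 1 ≤ k) (ht : 1 ≤ t) :
    ∃ f : Fin k → Fin 1 → Polynomial ℝ, (∀ i j, (f i j).support.card ≤ t) ∧ (∑ i, ∏ j, f i j) ≠ 0 ∧
      k * 1 * (t - 1) + k - 1 ≤ ((∑ i, ∏ j, f i j).roots.toFinset.filter (0 < ·)).card := by
  obtain ⟨n, rfl⟩ : ∃ n, t = n + 1 := ⟨t - 1, by omega⟩
  set N : ℕ := k * n + k - 1 with hN
  set s : Multiset ℝ := (Multiset.range N).map (fun i : ℕ => (i : ℝ) + 1) with hs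
  set P : Polynomial ℝ := (s.map fun r => X - C r).prod with hP
  have hinj : Function.Injective (fun i : ℕ => (i : ℝ) + 1) := fun a b h => by
    exact_mod_cast (add_right_cancel h : (a : ℝ) = b)
  have hnd : s.Nodup := (Multiset.nodup_range N).map hinj
  have hsN : Multiset.card s = N := by rw [hs, Multiset.card_map, Multiset.card_range]
  have hroots : P.roots = s := by rw [hP, roots_multiset_prod_X_sub_C]
  have hP0 : P ≠ 0 := by
    rw [hP]; exact (monic_multiset_prod_of_monic _ _ fun r _ => monic_X_sub_C r).ne_zero
  have hdeg : P.natDegree = N := by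
    rw [hP, natDegree_multiset_prod_X_sub_C_eq_card, hsN]
  have hlt : P.natDegree < k * (n + 1) := by
    rw [hdeg, hN, Nat.mul_succ]; omega
  have key : (∑ i : Fin k, ∏ _j : Fin 1,
      ∑ l : Fin (n + 1), C (P.coeff ((l : ℕ) + (n + 1) * (i : ℕ))) * X ^ ((l : ℕ) + (n + 1) * (i : ℕ)))
        = P := by
    simp only [Finset.prod_const, Finset.card_univ, Fintype.card_fin, pow_one]
    exact sum_blocks_eq P k (n + 1) hlt
  refine ⟨fun i _ => ∑ l : Fin (n + 1), C (P.coeff ((l : ℕ) + (n + 1) * (i : ℕ))) *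
      X ^ ((l : ℕ) + (n + 1) * (i : ℕ)),
    fun i _ => card_support_block_le P (n + 1) i, by rw [key]; exact hP0, ?_⟩
  rw [key]
  have hpos : ∀ x ∈ P.roots.toFinset, (0 : ℝ) < x := by
    intro x hx
    rw [hroots, Multiset.mem_toFinset, hs, Multiset.mem_map] at hx
    obtain ⟨i, -, rfl⟩ := hx
    positivity
  rw [Finset.filter_true_of_mem hpos, hroots, Multiset.toFinset_card_of_nodup hnd, hsN, hN]
  simp only [mul_one, Nat.add_sub_cancel]
  exact le_rfl

/-- Face `k = 1` of `AdditiveCountAttained`, for ALL `m` and `t ≥ 1` (Koiran's `k = 1` theorem is sharp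
in the crux's own format): one product of `m` polynomials of degree `t - 1`,
`f_j = ∏_{l<t-1} (X - (j(t-1)+l+1))`, has `m (t-1)` distinct zeros in `(0,∞)`.  Hence any valid bound
in the crux is `≥ m (t-1)` at `k = 1`. [folklore] -/
theorem additiveCount_attained_k_one (m t : ℕ) (ht : 1 ≤ t) :
    ∃ f : Fin 1 → Fin m → Polynomial ℝ, (∀ i j, (f i j).support.card ≤ t) ∧ (∑ i, ∏ j, f i j) ≠ 0 ∧
      1 * m * (t - 1) + 1 - 1 ≤ ((∑ i, ∏ j, f i j).roots.toFinset.filter (0 < ·)).card := by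
  obtain ⟨n, rfl⟩ : ∃ n, t = n + 1 := ⟨t - 1, by omega⟩
  simp only [Nat.add_sub_cancel, one_mul]
  -- the root used at position (j, l): r (l + n j) with r i = i + 1
  let r : ℕ → ℝ := fun i => (i : ℝ) + 1
  let g : Fin m → Polynomial ℝ := fun j => ∏ l : Fin n, (X - C (r ((l : ℕ) + n * (j : ℕ))))
  have hinj : Function.Injective r := fun a b h => by
    exact_mod_cast (add_right_cancel h : (a : ℝ) = b)
  set s : Multiset ℝ := (Multiset.range (m * n)).map r with hs
  have hnd : s.Nodup := (Multiset.nodup_range _).map hinj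
  have hsN : Multiset.card s = m * n := by rw [hs, Multiset.card_map, Multiset.card_range]
  -- ∏_j g j = ∏_{i < m n} (X - C (r i))
  have hprod : (∏ j : Fin m, g j) = (s.map fun x => X - C x).prod := by
    calc (∏ j : Fin m, g j) = ∏ x : Fin m × Fin n, (X - C (r ((x.2 : ℕ) + n * (x.1 : ℕ)))) :=
          (Fintype.prod_prod_type' _).symm
      _ = ∏ x : Fin m × Fin n, (fun i : Fin (m * n) => X - C (r (i : ℕ))) (finProdFinEquiv x) := rfl
      _ = ∏ i : Fin (m * n), (X - C (r (i : ℕ))) :=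
          Equiv.prod_comp finProdFinEquiv (fun i : Fin (m * n) => X - C (r (i : ℕ)))
      _ = ∏ i ∈ range (m * n), (X - C (r i)) := Fin.prod_univ_eq_prod_range (fun i => X - C (r i)) _
      _ = (s.map fun x => X - C x).prod := by
          rw [Finset.prod_eq_multiset_prod, Finset.range_val, hs, Multiset.map_map]; rfl
  have hP0 : (∏ j : Fin m, g j) ≠ 0 := by
    rw [hprod]; exact (monic_multiset_prod_of_monic _ _ fun x _ => monic_X_sub_C x).ne_zero
  have hroots : (∏ j : Fin m, g j).roots = s := by rw [hprod, roots_multiset_prod_X_sub_C]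
  have hsupp : ∀ j, (g j).support.card ≤ n + 1 := by
    intro j
    refine (card_supp_le_succ_natDegree _).trans ?_
    have : (g j).natDegree = n := by
      show (∏ l : Fin n, (X - C (r ((l : ℕ) + n * (j : ℕ))))).natDegree = n
      rw [natDegree_prod_of_monic _ _ fun l _ => monic_X_sub_C _]
      simp
    rw [this]
  have key : (∑ _i : Fin 1, ∏ j : Fin m, g j) = ∏ j : Fin m, g j := by simp
  refine ⟨fun _ j => g j, fun _ j => hsupp j, by rw [key]; exact hP0, ?_⟩
  rw [key]
  have hpos : ∀ x ∈ (∏ j : Fin m, g j).roots.toFinset, (0 : ℝ) < x := by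
    intro x hx
    rw [hroots, Multiset.mem_toFinset, hs, Multiset.mem_map] at hx
    obtain ⟨i, -, rfl⟩ := hx
    show (0 : ℝ) < (i : ℝ) + 1
    positivity
  rw [Finset.filter_true_of_mem hpos, hroots, Multiset.toFinset_card_of_nodup hnd, hsN]

/-! ### (n) the rank-3 quadratic stratum (lead's Q1) contains the `f g + 1` problem -/

/-- The lead's first sub-target Q1 (crux NOTES cycle 2: zeros of `a² + b² - c²`, equivalently
`p q - b²`, for `p, q, b` CO-SUPPORTED `T`-nomials — the rank-3 quadratic stratum of the Waring normal
form at `m = 2`) CONTAINS the `f g + 1` problem of Koiran 2011 / KPT15 §1 (is `Z_ℝ(fg+1) = O(t)` for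
`t`-sparse `f, g`? open): pad the supports — `f`, `g` and `1` are all supported in
`E = supp f ∪ supp g ∪ {0}`, `|E| ≤ 2t + 1`.  So any bound `B T` for the stratum gives `Z(fg - 1) ≤ B(2t+1)`;
in particular an `O(T)` answer to Q1 would settle the `f g + 1` problem — Q1's upper-bound direction is
not a warm-up but at least the 2011 open problem (its lower-bound direction is the calibration the
disprover's kit job measures). [folklore] -/
theorem card_roots_fg_sub_one_le_of_quadraticStratum (B : ℕ → ℕ)
    (hQ : ∀ (T : ℕ) (E : Finset ℕ) (p q b : ℝ[X]), E.card ≤ T → p.support ⊆ E → q.support ⊆ E →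
      b.support ⊆ E → p * q - b ^ 2 ≠ 0 → (p * q - b ^ 2).roots.toFinset.card ≤ B T)
    (t : ℕ) (f g : ℝ[X]) (hf : f.support.card ≤ t) (hg : g.support.card ≤ t) (h : f * g - 1 ≠ 0) :
    (f * g - 1).roots.toFinset.card ≤ B (2 * t + 1) := by
  set E : Finset ℕ := f.support ∪ g.support ∪ (1 : ℝ[X]).support with hE
  have h1 : (1 : ℝ[X]).support.card ≤ 1 := by
    simpa using (card_support_C_mul_X_pow_le_one (c := (1 : ℝ)) (n := 0))
  have hcard : E.card ≤ 2 * t + 1 :=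
    calc E.card ≤ (f.support ∪ g.support).card + (1 : ℝ[X]).support.card := card_union_le _ _
      _ ≤ (f.support.card + g.support.card) + (1 : ℝ[X]).support.card :=
          Nat.add_le_add_right (card_union_le _ _) _
      _ ≤ (t + t) + 1 := Nat.add_le_add (Nat.add_le_add hf hg) h1
      _ = 2 * t + 1 := by ring
  have h' : f * g - 1 ^ 2 ≠ 0 := by simpa using h
  have := hQ (2 * t + 1) E f g 1 hcard
    (subset_union_left.trans subset_union_left)
    (subset_union_right.trans subset_union_left) subset_union_right h'
  simpa using this

/-- … and `f g + 1` itself is the case `(-f) g - 1` (same zero set). [folklore] -/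
theorem roots_fg_add_one (f g : ℝ[X]) : (f * g + 1).roots = ((-f) * g - 1).roots := by
  rw [show (-f) * g - 1 = -(f * g + 1) by ring, roots_neg]

/-! ### (o) co-supported forms cannot be scale-separated (why the additive lower-bound mechanism does not
transfer to the Waring normal form) -/

/-- DOMINANCE PROPAGATES TO THE RIGHT OF A FULL TIE (archimedean tropicalisation of co-supported forms).
Lines `l ↦ a_l + e_l u` (log-magnitudes of the monomials of a `T`-nomial at `x = e^u`) with COMMON slopes
`e_l ≤ e_{iT}`: if all lines of the first form tie at `u₀` (full Descartes activity there — what a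
`T`-nomial with `T - 1` zeros near `e^{u₀}` looks like) and strictly dominate every line of a second,
CO-SUPPORTED form at `u₀`, then the top line of the first form strictly dominates the whole second form
at every `u ≥ u₀` (symmetrically to the left with the least slope).  Consequence (Disproof.lean Part III):
in `Σ_i ε_i h_i^m` with co-supported `h_i` (the lead's `stub_waringCore` normal form) at most ONE `h_i`
can be fully active where it dominates, so the disjoint-windows design behind
`additiveCount_attained_2_2_2` / `waringCount_attained_3_2_2` (supports shifted by monomial prefactors)
has no co-supported analogue: zeros there must come from ties BETWEEN forms. [folklore] -/
theorem coSupported_dominance_propagates {T : ℕ} (e a a' : Fin T → ℝ) (iT : Fin T)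
    (hmax : ∀ l, e l ≤ e iT) (u₀ u M : ℝ) (hu : u₀ ≤ u)
    (htie : ∀ l, a l + e l * u₀ = M) (hdom : ∀ l, a' l + e l * u₀ < M) :
    ∀ l, a' l + e l * u < a iT + e iT * u := by
  intro l
  have h1 : e l * (u - u₀) ≤ e iT * (u - u₀) := mul_le_mul_of_nonneg_right (hmax l) (by linarith)
  have h2 := hdom l
  have h3 := htie iT
  nlinarith


/-! ### (q) LP-certified alternation search (kit j025721; smoke j025675) — PENDING at this revision

Method (job/main.py): `F` is affine in each linear block of coefficients (A: `p | q | b`-linearised;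
B: `P | δ-lin | η-lin`; C: `f₁ | f₂ | g₁ | g₂`).  One representative grid point per constant-sign run of `F` on a
log-grid of dyadic points (`u ∈ [-40, 40]`, 3000–5000 points); a move FLIPS the sign at an interior point of a run
while every representative keeps its sign — an LP (maximal relative margin, scipy HiGHS) in locally rescaled
log-domain coordinates; accepted iff the number of alternations on the full grid grows (plateau moves with
probability 0.3; exponent mutations, rigid rescalings, single-coefficient jiggles for drift); structured restarts
at the additive optimum (C: gen-1 scale separation, exactly `4t - 3` at start; A: `p ≈ q ≈ b` perturbations of a
Descartes-sharp `b`) and random balanced restarts; every record re-verified in EXACT rational arithmetic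
(dyadic coefficients and points) — a certified lower bound on the number of distinct zeros in `(0,∞)` by
`le_card_pos_roots_of_alternating`.  Baselines printed per task: A: `6T - 4` (window separation, NOT available
co-supported by (o)), `2T + 1`, Descartes `|e+e| - 1`; B: `D - 1`, `m(T-1)`, `m(2T-2)+1`; C: `4t - 3`, `2t² - 1`.
Local dry runs (pure-python LP, minutes): C stays at `4t - 3` for `t = 3, 4` (no single-block LP flip exists at
the scale-separated optimum in ~2·10⁴ proposals), A reaches 14 at `T = 8`, B reaches 14 at `(m,T) = (2,6)`.
RESULTS: to be filled in from `~/compute/j025721/outputs/table.txt` at the next boundary.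
-/

end Summit.ValiantsHypothesis.ValiantsHypothesis.Cruxes.RealTauRefined.Disproof
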